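import Literature.NumberTheory.Sieve.AsymptoticSieveForPrimesSmoothRough
import Literature.NumberTheory.Sieve.AsymptoticSieveForPrimesRoughK
import Literature.NumberTheory.Sieve.AsymptoticSieveForPrimesS3Assembly
import Literature.NumberTheory.Sieve.AsymptoticSieveForPrimesHolds
import HarnessLib

/-!
# Asymptotic sieve for primes under (B*): the estimate (8.5) of `S₃(x; y, Z)` from the sieved bilinear hypothesis (FI §10 applied to §8)

Topic `Literature/NumberTheory/Sieve` (trunk T-SIEVE), a sequel of
`Literature.NumberTheory.Sieve.AsymptoticSieveForPrimesRough`. Source: J. Friedlander, H. Iwaniec,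
*Asymptotic sieve for primes*, Ann. of Math. 148 (1998) 1041–1065 [FriedlanderIwaniecASP1998]
(= arXiv:math/9811186), §8 "Estimation of `S₃(x; Y, Z)`" ((8.1)–(8.5), p. 1057–1058) and §10
"A reduction of the bilinear form" (Theorem 3, (10.1)–(10.5), pp. 1063–1065):

"For the proof it is enough to show that (B*) implies (B) with `δ, Δ` replaced by `2δ, 2Δ²`.
Furthermore we only need to establish (B) in the following integrated form
(B̃) `∫_N^{2N} ∫_1^C ∑_m |∑_{w<n≤2w} γ(n;t) μ(mn) a_{mn}| dt dw/(tw) ≪ A(x)(log x)^{-2^{22}}` …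
in two cases `γ(n;t) = 1` and (10.3) `γ(n;t) = ∑_{d∣n, d≤t} μ(d)`. To see this recall that (B) was
used solely to estimate the sums `S₂` and `S₃` in Sections 7 and 8. … In the case of `S₃` we note that
(8.1) may be integrated over `z` in place of `w` and there `λ⁻(c)` is the integral of `γ(c;t)` as
required. We write `n = n₀n₁` where `(n₀, Π) = 1` and `n₁ ∣ Π`. The contribution to (B̃) from terms
with `n₁ > Δ` is estimated trivially … by Rankin's trick. We choose `ε = (log P)⁻¹` … (10.4)
`W₁ ≪ A(x)(log x)^{-2^{33}}`. Next we estimate the contribution of terms with `n₁ ≤ Δ` … In the case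
(10.3) we have `γ(n₀n₁;t) = ∑_{d₁∣n₁} μ(d₁) γ(n₀; t/d₁)`. Insert this and change variables
`t → td₁`, `w → wn₁` getting `W₀ ≤ ∫∫ ∑_m τ₃(m) |∑*_{w<n≤2w} γ(n;t) μ(mn) a_{mn}| dt dw/(tw)` … By
the argument that gave (B) ⟹ (B′) it follows that (B*) implies … (10.5) `W₀ ≪ A(x)(log x)^{-2^{22}}`.
Adding (10.4) to (10.5) we obtain (B̃) completing the proof of Theorem 3."

This file DISCHARGES the named fact `Literature.NumberTheory.Sieve.fi_asp_S3_estimate_rough`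
(`…Rough`: FI (8.5), `|∫_Z^{eZ} S₃(x; y, z) dz/z| ≤ K A(x)/log x`, over `FIRegimeRough`, i.e. with the
bilinear hypothesis (B*) — inner variable free of prime factors `< P` — in place of (B)):
**`fi_asp_S3_estimate_rough_holds`**. With `…CoreEstimates` ((4.5), (5.1), (6.6) over the core
regime) and `…RoughAssembly`, the named fact `fi_asymptotic_sieve_primes_rough_loglog` (Theorem 1
with (B*), the case of [FriedlanderIwaniecAnnals1998] Proposition 2.1 applied to
`μ²(n) #{(a,c) : a² + c⁴ = n}`) then follows from the single remaining estimate
`fi_asp_S2_estimate_rough` ((7.2) under (B*), the case `γ = 1` of the same argument).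

## The argument (FI §8 with §10 in place of (B′)), as formalised

`S₃ = S* + S' − S⁻` pointwise in `z` (`…S3Minus`, `…S3Plus`); `S*` and `S'` are treated exactly as in
the tree's `fi_asp_S3_estimate_of_cancellation` (`…S3Assembly`: (2.4) — the theorem
`fi_moebius_density_cancellation_holds` — and (R′), no bilinear input). For `S⁻`, with the discrete
`λ⁻(c) = ∑_{1≤j<C₀} log((j+1)/j) γ(c; j)`, `C₀ = ⌈x/D⌉`, and `T_j(k,z) = ∑_{c≤x/k, z<c≤sz} γ(c;j) μ(c) a_{kc}`:

* `abs_S3minus_le_weighted_sum`: `|S⁻(z)| ≤ ∑_j log((j+1)/j) ∑_k τ(k)² |T_j(k,z)|` (`|M(k)|ρ_k ≤ τ(k)²`);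
* `abs_T_le_smooth_add_large`: the decomposition `c = n₁n₀`, `n₁` squarefree `P`-smooth, `n₀`
  `P`-rough (`sum_Icc_eq_sum_sqfree_smooth_sum_rough`; `μ(c) = 0` off the squarefree `c`),
  `γ(n₀n₁; j) = ∑_{d₁∣n₁} μ(d₁) γ(n₀; ⌊j/d₁⌋)` (`inner_rough_sum_eq`, from `fiGamma_mul_of_coprime`),
  split at `n₁ ≤ Δ = x^{θ/2}` (the level of the weights); for `n₁ > Δ` the trivial bound
  `τ(n₁n₀) a_{kn₁n₀}`;
* `sum_log_sum_divisors_abs_le`: the `j`-regrouping `∑_j log((j+1)/j) F(⌊j/d₁⌋) ≤ ∑_q log((q+1)/q) F(q)`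
  (the discrete `t → td₁`; `γ(·;0) = 0`) collapses the `d₁`-sum into a factor `τ(n₁)`;
* `sum_large_smooth_le_rankin`, `sum_tau_sq_sum_tau_cube_le`: `W₁ ≤ Δ^{-ε} ∑_{n≤x} a_n τ(n)⁶`
  (`1 ≤ Δ^{-ε} n₁^{ε} ≤ Δ^{-ε} e^{ω(n₁)} ≤ Δ^{-ε} τ(n₁)²`, `ε = 1/log P`), and `rankin_rpow_le_log_rpow`:
  (10.2) `P ≤ Δ_B^{1/(2^{35} log log x)}`, `Δ_B = x^{2θ}`, gives `Δ^{-ε} ≤ (log x)^{-2^{33}}`, so with the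
  sixth moment `∑ a_n τ(n)⁶ ≪ A(x)(log x)^{2^{26}}` (`…SmoothRough`), `W₁`'s contribution is
  `≤ 2 C₆ A(x)(log x)^{-6}` (`weighted_T_sum_le` collects the pointwise bound `W₀(z) + W₁`);
* `integral_W0_le`: after `∫_Y^{eY} dz/z`, the change of variables `u = z/n₁`
  (`intervalIntegral_comp_div_le`, `1 ≤ n₁ ≤ Δ`), the reindexing `ℓ = kn₁` with
  `∑_{kn₁=ℓ} τ(k)²τ(n₁) = 6^{ω(ℓ)}` (`sum_tau_sq_sum_tau_mul_le`), the dyadic pieces of `(u, su]`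
  (`abs_rough_inner_le_sum_pieces`: the inner sums of `fiBilinearRough` at `N = 2^i u`) and the reduced
  sieved bilinear bound with weight `6^{ω}` (`reduced_rough_bilinear_bound_six`, `…RoughBilinear`) give
  `∫ W₀ dz/z ≤ log C₀ · k₀ · K_B A(x)(log x)^{-5} · (1 + log Δ) ≤ 16 K_B A(x)(log x)^{-2}`; the pieces lie
  in the range (B1) for `Δ_B = x^{2θ}` because `u > Y/Δ = x^{-θ}√D ≥ x^{-2θ}√D` — FI's "`Δ` replaced
  by `2Δ²`";
* `fi_asp_S3_estimate_roughK`: the assembly, `|S₃(x; y, Z)| ≤ (K* + 16K_B + 6K_R + 2C₆) A(x)/log x`,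
  stated with the clauses unbundled and (B*) carrying an implied constant `K_B*` (as printed,
  p. 1063 "`≪`"; needed by FI's Theorem 2, §9, where (B*) for `ã = μ²a` is normalised by
  `Ã(x) = G A(x)(1 + o(1))`, `G < 1`), the reduced bound coming from `…RoughK`;
  `fi_asp_S3_estimate_rough_holds`: the case `K_B* = 1`, i.e. the named fact over `FIRegimeRough`.

## References

* J. Friedlander, H. Iwaniec, *Asymptotic sieve for primes*, Ann. of Math. 148 (1998), 1041–1065,
  §8 (8.1)–(8.5) and §10 (10.1)–(10.5), Theorem 3. [cite: FriedlanderIwaniecASP1998, §8 (8.5) and §10 Theorem 3]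

## Mathlib / tree search

Tree (reused): `abs_fiS3_le_three`, `abs_S3star_le`, `abs_S3prime_le`, `integral_boundary_terms_le`,
`intervalIntegrable_boundary_terms`, `sum_divisors_moebius_posLog_eq_sum_gamma`,
`sum_gamma_moebius_mul_a_eq`, `abs_truncGT_moebius_mul_zeta_le`, `sieveRho_le_card_divisors`
(`…S3Minus/S3Plus/S3Assembly`); `sum_ite_Ioc_pow_eq_sum_range`, `intervalIntegral_comp_div_le`,
`intervalIntegrable_comp_div_div`, `intervalIntegrable_finset_sum_fun`, `nat_le_four_mul_log_of_two_pow_le`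
(`…S2`); `sum_sum_le_sum_divisorsAntidiagonal` (`…Reduction`);
`FIAsymptoticSieveHypothesesCore.reduced_rough_bilinear_bound_six_of_bilinear` (`…RoughK`); `sum_Icc_eq_sum_sqfree_smooth_sum_rough`, `fiGamma_mul_of_coprime`,
`sum_Ico_log_mul_apply_div_le`, `sum_a_mul_card_divisors_pow_six_le`, `one_le_rpow_neg_mul_rpow`,
`rpow_inv_log_le_exp_card_primeFactors`, `exp_card_primeFactors_le_card_divisors_sq` (`…SmoothRough`);
`fi_moebius_density_cancellation_holds` (`…Cancellation`), `fi_reduced_remainder_bound_holds`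
(`…Reduction`), `FIRegimeRough`, `fi_asp_S3_estimate_rough` (`…Rough`). Mathlib: `Nat.divisors_subset_of_dvd`,
`Nat.map_div_right_divisors`, `Nat.disjoint_primeFactors`, `Measurable.ite`,
`intervalIntegral.integral_mono_on_of_le_Ioo`, `integral_inv`. `lean search` for every new name: no
declaration before this file.
-/

noncomputable section

open Filter Finset
open scoped ArithmeticFunction.Moebius ArithmeticFunction.vonMangoldt ArithmeticFunction.zeta
  ArithmeticFunction.omega ArithmeticFunction.sigma

namespace Literature.NumberTheory.Sieve

open MeasureTheory
open scoped Topology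

/-! ### The structural bound for `S⁻` with the weight `τ(k)²` -/

variable {A : SieveSequence} in
/-- **(8.1), structural form**: with `λ⁻(c) = ∑_{1≤j<C₀} log((j+1)/j) γ(c; j)`
(`sum_divisors_moebius_posLog_eq_sum_gamma`) and `|M(k)| ρ_k ≤ τ(k)²`,
`|S⁻(x; y, z)| ≤ ∑_{j<C₀} log((j+1)/j) ∑_{k≤x} τ(k)² |∑_{c ≤ x/k, z<c≤sz} γ(c;j) μ(c) a_{kc}|`
(the first steps of the proof of `abs_S3minus_le`, before (B′) is applied; here for any real `s`).
[cite: FriedlanderIwaniecASP1998, §8 (8.1)] -/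
theorem abs_S3minus_le_weighted_sum {P L : ℝ} {lam : ℕ → ℤ} (hw : IsUpperSieveWeights P L lam)
    (x y z s : ℝ) (C₀ : ℕ) :
    |∑ c ∈ Icc 1 ⌊x⌋₊, ∑ k ∈ Icc 1 (⌊x⌋₊ / c),
        (if z < (c : ℝ) ∧ (c : ℝ) ≤ s * z then
          (truncGT (μ : ArithmeticFunction ℝ) (s * y) * ζ) k * (sieveRho lam k : ℝ) *
            ((μ c : ℝ) * ∑ m ∈ c.divisors, (μ m : ℝ) * Real.posLog ((C₀ : ℝ) / m)) * A.a (k * c)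
        else 0)| ≤
      ∑ j ∈ Ico 1 C₀, Real.log (((j : ℝ) + 1) / j) *
        ∑ k ∈ Icc 1 ⌊x⌋₊, ((k.divisors.card : ℝ)) ^ 2 *
          |∑ c ∈ Icc 1 (⌊x⌋₊ / k), (if z < (c : ℝ) ∧ (c : ℝ) ≤ s * z then
              (SieveSequence.fiGamma j c : ℝ) * (μ c : ℝ) * A.a (k * c) else 0)| := by
  classical
  set X := ⌊x⌋₊ with hX
  set M : ℕ → ℝ := fun k => (truncGT (μ : ArithmeticFunction ℝ) (s * y) * ζ) k with hM
  set w : ℕ → ℝ := fun j => Real.log (((j : ℝ) + 1) / j) with hw'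
  have hw0 : ∀ j ∈ Ico 1 C₀, 0 ≤ w j := fun j hj => log_succ_div_nonneg (Finset.mem_Ico.mp hj).1
  set T : ℕ → ℕ → ℝ := fun j k =>
    ∑ c ∈ Icc 1 (X / k), (if z < (c : ℝ) ∧ (c : ℝ) ≤ s * z then
      (SieveSequence.fiGamma j c : ℝ) * (μ c : ℝ) * A.a (k * c) else 0) with hT
  -- Step 1: insert the `γ`-representation and pull the `j`-sum out
  have hrepr : ∑ c ∈ Icc 1 X, ∑ k ∈ Icc 1 (X / c),
      (if z < (c : ℝ) ∧ (c : ℝ) ≤ s * z then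
        M k * (sieveRho lam k : ℝ) *
          ((μ c : ℝ) * ∑ m ∈ c.divisors, (μ m : ℝ) * Real.posLog ((C₀ : ℝ) / m)) * A.a (k * c)
        else 0) =
      ∑ j ∈ Ico 1 C₀, w j * ∑ k ∈ Icc 1 X, M k * (sieveRho lam k : ℝ) * T j k := by
    rw [sum_Icc_div_comm (fun k c => if z < (c : ℝ) ∧ (c : ℝ) ≤ s * z then
        M k * (sieveRho lam k : ℝ) *
          ((μ c : ℝ) * ∑ m ∈ c.divisors, (μ m : ℝ) * Real.posLog ((C₀ : ℝ) / m)) * A.a (k * c)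
        else 0) X]
    have hR : ∑ j ∈ Ico 1 C₀, w j * ∑ k ∈ Icc 1 X, M k * (sieveRho lam k : ℝ) * T j k =
        ∑ k ∈ Icc 1 X, ∑ c ∈ Icc 1 (X / k), ∑ j ∈ Ico 1 C₀,
          (if z < (c : ℝ) ∧ (c : ℝ) ≤ s * z then
            w j * (M k * (sieveRho lam k : ℝ) *
              ((SieveSequence.fiGamma j c : ℝ) * (μ c : ℝ) * A.a (k * c))) else 0) := by
      calc ∑ j ∈ Ico 1 C₀, w j * ∑ k ∈ Icc 1 X, M k * (sieveRho lam k : ℝ) * T j k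
          = ∑ j ∈ Ico 1 C₀, ∑ k ∈ Icc 1 X, ∑ c ∈ Icc 1 (X / k),
              (if z < (c : ℝ) ∧ (c : ℝ) ≤ s * z then
                w j * (M k * (sieveRho lam k : ℝ) *
                  ((SieveSequence.fiGamma j c : ℝ) * (μ c : ℝ) * A.a (k * c))) else 0) := by
            refine Finset.sum_congr rfl fun j _ => ?_
            rw [Finset.mul_sum]
            refine Finset.sum_congr rfl fun k _ => ?_
            rw [hT, Finset.mul_sum, Finset.mul_sum]
            refine Finset.sum_congr rfl fun c _ => ?_
            split_ifs <;> ring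
        _ = _ := by
            rw [Finset.sum_comm]
            exact Finset.sum_congr rfl fun k _ => Finset.sum_comm
    rw [hR]
    refine Finset.sum_congr rfl fun k hk => Finset.sum_congr rfl fun c hc => ?_
    split_ifs with hzc
    · rw [sum_divisors_moebius_posLog_eq_sum_gamma C₀ c, Finset.mul_sum, Finset.mul_sum,
        Finset.sum_mul]
      exact Finset.sum_congr rfl fun j _ => by ring
    · simp
  rw [hrepr]
  -- Step 2: triangle inequality and `|M(k)| ρ_k ≤ τ(k)²`
  refine (Finset.abs_sum_le_sum_abs _ _).trans (Finset.sum_le_sum fun j hj => ?_)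
  rw [abs_mul, abs_of_nonneg (hw0 j hj)]
  refine mul_le_mul_of_nonneg_left ?_ (hw0 j hj)
  refine (Finset.abs_sum_le_sum_abs _ _).trans (Finset.sum_le_sum fun k _ => ?_)
  rw [abs_mul, abs_mul]
  have h1 : |M k| ≤ (k.divisors.card : ℝ) := abs_truncGT_moebius_mul_zeta_le _ k
  have h2 : |(sieveRho lam k : ℝ)| ≤ (k.divisors.card : ℝ) := by
    rw [abs_of_nonneg (by exact_mod_cast hw.sieveRho_nonneg k)]
    exact hw.sieveRho_le_card_divisors k
  calc |M k| * |(sieveRho lam k : ℝ)| * |T j k|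
      ≤ (k.divisors.card : ℝ) * (k.divisors.card : ℝ) * |T j k| :=
        mul_le_mul_of_nonneg_right (mul_le_mul h1 h2 (abs_nonneg _) (Nat.cast_nonneg _))
          (abs_nonneg _)
    _ = ((k.divisors.card : ℝ)) ^ 2 * |T j k| := by rw [sq]

/-! ### Small tools: the window after `c = n₁ n₀`, coprimality, `γ` at `j/d₁` -/

/-- The window `z < n₁n₀ ≤ s z` in terms of `n₀`: `z/n₁ < n₀ ≤ s (z/n₁)` (`n₁ > 0`). [folklore] -/
theorem window_mul_iff {n₁ : ℕ} (hn₁ : 0 < n₁) (n₀ : ℕ) (z s : ℝ) :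
    (z < ((n₁ * n₀ : ℕ) : ℝ) ∧ ((n₁ * n₀ : ℕ) : ℝ) ≤ s * z) ↔
      (z / n₁ < (n₀ : ℝ) ∧ (n₀ : ℝ) ≤ s * (z / n₁)) := by
  have h0 : (0 : ℝ) < n₁ := by exact_mod_cast hn₁
  push_cast
  rw [div_lt_iff₀ h0, show s * (z / n₁) = s * z / n₁ by ring, le_div_iff₀ h0]
  constructor <;> rintro ⟨h1, h2⟩ <;> constructor <;> linarith [mul_comm (n₀ : ℝ) n₁]

/-- A `P`-smooth and a `P`-rough positive integer are coprime. [folklore] -/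
theorem coprime_of_smooth_lt_of_rough_ge {P : ℝ} {n₁ n₀ : ℕ} (hn₁ : n₁ ≠ 0) (hn₀ : n₀ ≠ 0)
    (hs : ∀ p ∈ n₁.primeFactors, (p : ℝ) < P) (hr : ∀ p ∈ n₀.primeFactors, P ≤ (p : ℝ)) :
    Nat.Coprime n₁ n₀ := by
  rw [← Nat.disjoint_primeFactors hn₁ hn₀]
  exact Finset.disjoint_left.mpr fun p hp hp' => absurd (hs p hp) (not_lt.mpr (hr p hp'))

/-- `γ(n; j/d) = γ(n; ⌊j/d⌋)` for integers `j` and `d ≥ 1` (the divisors are integers).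
[folklore] -/
theorem fiGamma_natCast_div {j d : ℕ} (hd : 1 ≤ d) (n : ℕ) :
    SieveSequence.fiGamma ((j : ℝ) / d) n = SieveSequence.fiGamma ((j / d : ℕ) : ℝ) n := by
  rw [SieveSequence.fiGamma, SieveSequence.fiGamma]
  congr 1
  refine Finset.filter_congr fun e _ => ?_
  have hd0 : (0 : ℝ) < d := by exact_mod_cast hd
  rw [le_div_iff₀ hd0, ← Nat.cast_mul, Nat.cast_le, Nat.cast_le]
  exact (Nat.le_div_iff_mul_le hd).symm

/-! ### The inner sum after `c = n₁ n₀`: the smooth variable `n₁ ≤ Δ` (towards `W₀`) -/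

variable {A : SieveSequence} in
/-- **The inner sum over the rough variable, for a fixed smooth squarefree `n₁`** (FI §10 p. 1065:
"`γ(n₀n₁; t) = ∑_{d₁∣n₁} μ(d₁) γ(n₀; t/d₁)`. Insert this and change variables"): for `n₁ ≥ 1`
squarefree with all prime factors `< P`, `k ≥ 1`, and a finite set `R` of positive integers all of
whose prime factors are `≥ P`,
`∑_{n₀ ∈ R} [z < n₁n₀ ≤ sz] γ(n₁n₀; j) μ(n₁n₀) a_{k n₁ n₀}
  = μ(n₁) ∑_{d₁ ∣ n₁} μ(d₁) ∑_{n₀ ∈ R} [z/n₁ < n₀ ≤ s z/n₁] γ(n₀; ⌊j/d₁⌋) μ(n₀) a_{(k n₁) n₀}`.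
[cite: FriedlanderIwaniecASP1998, §10 p. 1065] -/
theorem inner_rough_sum_eq {P : ℝ} {n₁ : ℕ} (hn₁ : Squarefree n₁)
    (hs : ∀ p ∈ n₁.primeFactors, (p : ℝ) < P) (k j : ℕ) (z s : ℝ) (R : Finset ℕ)
    (hR : ∀ n₀ ∈ R, n₀ ≠ 0 ∧ ∀ p ∈ n₀.primeFactors, P ≤ (p : ℝ)) :
    ∑ n₀ ∈ R, (if z < ((n₁ * n₀ : ℕ) : ℝ) ∧ ((n₁ * n₀ : ℕ) : ℝ) ≤ s * z then
        (SieveSequence.fiGamma j (n₁ * n₀) : ℝ) * (μ (n₁ * n₀) : ℝ) * A.a (k * (n₁ * n₀)) else 0) =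
      (μ n₁ : ℝ) * ∑ d₁ ∈ n₁.divisors, (μ d₁ : ℝ) *
        ∑ n₀ ∈ R, (if z / n₁ < (n₀ : ℝ) ∧ (n₀ : ℝ) ≤ s * (z / n₁) then
          (SieveSequence.fiGamma ((j / d₁ : ℕ) : ℝ) n₀ : ℝ) * (μ n₀ : ℝ) * A.a (k * n₁ * n₀) else 0) := by
  classical
  have hn₁0 : n₁ ≠ 0 := hn₁.ne_zero
  have hn₁pos : 0 < n₁ := Nat.pos_of_ne_zero hn₁0
  -- right-hand side as a single sum over `n₀`
  have hR' : (μ n₁ : ℝ) * ∑ d₁ ∈ n₁.divisors, (μ d₁ : ℝ) *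
        ∑ n₀ ∈ R, (if z / n₁ < (n₀ : ℝ) ∧ (n₀ : ℝ) ≤ s * (z / n₁) then
          (SieveSequence.fiGamma ((j / d₁ : ℕ) : ℝ) n₀ : ℝ) * (μ n₀ : ℝ) * A.a (k * n₁ * n₀) else 0) =
      ∑ n₀ ∈ R, (μ n₁ : ℝ) * ∑ d₁ ∈ n₁.divisors, (μ d₁ : ℝ) *
        (if z / n₁ < (n₀ : ℝ) ∧ (n₀ : ℝ) ≤ s * (z / n₁) then
          (SieveSequence.fiGamma ((j / d₁ : ℕ) : ℝ) n₀ : ℝ) * (μ n₀ : ℝ) * A.a (k * n₁ * n₀) else 0) := by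
    simp only [Finset.mul_sum]
    rw [Finset.sum_comm]
  rw [hR']
  refine Finset.sum_congr rfl fun n₀ hn₀ => ?_
  obtain ⟨hn₀0, hr⟩ := hR n₀ hn₀
  have hcop : Nat.Coprime n₀ n₁ := (coprime_of_smooth_lt_of_rough_ge hn₁0 hn₀0 hs hr).symm
  by_cases hwin : z / n₁ < (n₀ : ℝ) ∧ (n₀ : ℝ) ≤ s * (z / n₁)
  · rw [if_pos ((window_mul_iff hn₁pos n₀ z s).mpr hwin)]
    simp_rw [if_pos hwin]
    rw [mul_comm n₁ n₀, fiGamma_mul_of_coprime hcop,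
      ArithmeticFunction.isMultiplicative_moebius.map_mul_of_coprime hcop, Int.cast_mul,
      Finset.sum_mul, Finset.sum_mul, Finset.mul_sum]
    refine Finset.sum_congr rfl fun d₁ hd₁ => ?_
    have hd₁1 : 1 ≤ d₁ := Nat.pos_of_mem_divisors hd₁
    rw [fiGamma_natCast_div hd₁1, show k * (n₀ * n₁) = k * n₁ * n₀ by ring]
    ring
  · rw [if_neg (fun h => hwin ((window_mul_iff hn₁pos n₀ z s).mp h))]
    simp_rw [if_neg hwin]
    simp

/-! ### `|T_j(k, z)|` after the decomposition `c = n₁ n₀`: the split at `n₁ ≤ Δ` -/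

variable {A : SieveSequence} in
/-- **The inner sum of (8.1) after `c = n₁n₀`** (FI §10: "We write `n = n₀n₁` … The contribution
from terms with `n₁ > Δ` is estimated trivially … Next we estimate the contribution of terms with
`n₁ ≤ Δ`"): for `k ≥ 1`, integers `j, X`, reals `z, s`, a sieving parameter `P` and a threshold
`Lw`,
`|∑_{c ≤ X/k, z<c≤sz} γ(c;j) μ(c) a_{kc}| ≤ ∑_{n₁ ≤ Lw} ∑_{d₁ ∣ n₁} |∑_{n₀ rough, z/n₁ < n₀ ≤ sz/n₁}
γ(n₀; ⌊j/d₁⌋) μ(n₀) a_{kn₁n₀}| + ∑_{n₁ > Lw} ∑_{n₀ rough} τ(n₁n₀) a_{kn₁n₀}`,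
`n₁` running over the squarefree `P`-smooth integers `≤ X/k` and `n₀` over the `P`-rough integers
`≤ X/(kn₁)`. [cite: FriedlanderIwaniecASP1998, §10 pp. 1064-1065] -/
theorem abs_T_le_smooth_add_large (P Lw : ℝ) (k j X : ℕ) (z s : ℝ) :
    |∑ c ∈ Icc 1 (X / k), (if z < (c : ℝ) ∧ (c : ℝ) ≤ s * z then
        (SieveSequence.fiGamma j c : ℝ) * (μ c : ℝ) * A.a (k * c) else 0)| ≤
      (∑ n₁ ∈ (Icc 1 (X / k)).filter (fun n : ℕ => Squarefree n ∧
          (∀ p ∈ n.primeFactors, (p : ℝ) < P) ∧ (n : ℝ) ≤ Lw),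
        ∑ d₁ ∈ n₁.divisors,
          |∑ n₀ ∈ (Icc 1 (X / (k * n₁))).filter (fun n : ℕ => ∀ p ∈ n.primeFactors, P ≤ (p : ℝ)),
            (if z / n₁ < (n₀ : ℝ) ∧ (n₀ : ℝ) ≤ s * (z / n₁) then
              (SieveSequence.fiGamma ((j / d₁ : ℕ) : ℝ) n₀ : ℝ) * (μ n₀ : ℝ) * A.a (k * n₁ * n₀)
            else 0)|) +
      ∑ n₁ ∈ (Icc 1 (X / k)).filter (fun n : ℕ => Squarefree n ∧
          (∀ p ∈ n.primeFactors, (p : ℝ) < P) ∧ Lw < (n : ℝ)),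
        ∑ n₀ ∈ (Icc 1 (X / (k * n₁))).filter (fun n : ℕ => ∀ p ∈ n.primeFactors, P ≤ (p : ℝ)),
          (((n₁ * n₀).divisors.card : ℝ)) * A.a (k * n₁ * n₀) := by
  classical
  set f : ℕ → ℝ := fun c => if z < (c : ℝ) ∧ (c : ℝ) ≤ s * z then
      (SieveSequence.fiGamma j c : ℝ) * (μ c : ℝ) * A.a (k * c) else 0 with hf
  have hf0 : ∀ c, ¬Squarefree c → f c = 0 := by
    intro c hc
    simp only [hf, ArithmeticFunction.moebius_eq_zero_of_not_squarefree hc, Int.cast_zero,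
      mul_zero, zero_mul, ite_self]
  set SM := (Icc 1 (X / k)).filter (fun n : ℕ => Squarefree n ∧ ∀ p ∈ n.primeFactors, (p : ℝ) < P)
    with hSM
  set RO : ℕ → Finset ℕ := fun n₁ =>
    (Icc 1 (X / (k * n₁))).filter (fun n : ℕ => ∀ p ∈ n.primeFactors, P ≤ (p : ℝ)) with hRO
  -- the decomposition
  have hdec : ∑ c ∈ Icc 1 (X / k), f c = ∑ n₁ ∈ SM, ∑ n₀ ∈ RO n₁, f (n₁ * n₀) := by
    rw [sum_Icc_eq_sum_sqfree_smooth_sum_rough P hf0 (X / k)]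
    refine Finset.sum_congr rfl fun n₁ _ => ?_
    rw [hRO, Nat.div_div_eq_div_mul]
  -- the two ranges of `n₁`
  have hsplit : ∑ n₁ ∈ SM, ∑ n₀ ∈ RO n₁, f (n₁ * n₀) =
      (∑ n₁ ∈ SM.filter (fun n : ℕ => (n : ℝ) ≤ Lw), ∑ n₀ ∈ RO n₁, f (n₁ * n₀)) +
      ∑ n₁ ∈ SM.filter (fun n : ℕ => ¬ (n : ℝ) ≤ Lw), ∑ n₀ ∈ RO n₁, f (n₁ * n₀) :=
    (Finset.sum_filter_add_sum_filter_not SM (fun n : ℕ => (n : ℝ) ≤ Lw) _).symm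
  have hS1 : SM.filter (fun n : ℕ => (n : ℝ) ≤ Lw) = (Icc 1 (X / k)).filter (fun n : ℕ =>
      Squarefree n ∧ (∀ p ∈ n.primeFactors, (p : ℝ) < P) ∧ (n : ℝ) ≤ Lw) := by
    rw [hSM, Finset.filter_filter]
    refine Finset.filter_congr fun n _ => ?_
    tauto
  have hS2 : SM.filter (fun n : ℕ => ¬ (n : ℝ) ≤ Lw) = (Icc 1 (X / k)).filter (fun n : ℕ =>
      Squarefree n ∧ (∀ p ∈ n.primeFactors, (p : ℝ) < P) ∧ Lw < (n : ℝ)) := by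
    rw [hSM, Finset.filter_filter]
    refine Finset.filter_congr fun n _ => ?_
    rw [not_le]
    tauto
  show |∑ c ∈ Icc 1 (X / k), f c| ≤ _
  rw [hdec, hsplit, hS1, hS2]
  refine (abs_add_le _ _).trans (add_le_add ?_ ?_)
  · -- `n₁ ≤ Lw`: the identity `inner_rough_sum_eq` and `|μ| ≤ 1`
    refine (Finset.abs_sum_le_sum_abs _ _).trans (Finset.sum_le_sum fun n₁ hn₁ => ?_)
    obtain ⟨-, hsq, hsm, -⟩ := Finset.mem_filter.mp hn₁
    have hR : ∀ n₀ ∈ RO n₁, n₀ ≠ 0 ∧ ∀ p ∈ n₀.primeFactors, P ≤ (p : ℝ) := by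
      intro n₀ hn₀
      obtain ⟨hI, hr⟩ := Finset.mem_filter.mp hn₀
      exact ⟨Nat.one_le_iff_ne_zero.mp (Finset.mem_Icc.mp hI).1, hr⟩
    have heq := inner_rough_sum_eq (A := A) hsq hsm k j z s (RO n₁) hR
    simp only [hf] at heq ⊢
    rw [heq, abs_mul]
    have hμ : |(μ n₁ : ℝ)| ≤ 1 := by exact_mod_cast ArithmeticFunction.abs_moebius_le_one
    calc |(μ n₁ : ℝ)| * |∑ d₁ ∈ n₁.divisors, (μ d₁ : ℝ) * _|
        ≤ 1 * ∑ d₁ ∈ n₁.divisors, |(μ d₁ : ℝ) * _| :=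
          mul_le_mul hμ (Finset.abs_sum_le_sum_abs _ _) (abs_nonneg _) zero_le_one
      _ ≤ 1 * ∑ d₁ ∈ n₁.divisors, _ := by
          refine mul_le_mul_of_nonneg_left (Finset.sum_le_sum fun d₁ _ => ?_) zero_le_one
          rw [abs_mul]
          have hμ' : |(μ d₁ : ℝ)| ≤ 1 := by exact_mod_cast ArithmeticFunction.abs_moebius_le_one
          calc |(μ d₁ : ℝ)| * _ ≤ 1 * _ := mul_le_mul_of_nonneg_right hμ' (abs_nonneg _)
            _ = _ := one_mul _
      _ = _ := one_mul _
  · -- `n₁ > Lw`: trivially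
    refine (Finset.abs_sum_le_sum_abs _ _).trans (Finset.sum_le_sum fun n₁ _ => ?_)
    refine (Finset.abs_sum_le_sum_abs _ _).trans (Finset.sum_le_sum fun n₀ _ => ?_)
    simp only [hf]
    split_ifs
    · rw [abs_mul, abs_mul, abs_of_nonneg (A.a_nonneg _), mul_assoc k n₁ n₀]
      have hγ : |(SieveSequence.fiGamma j (n₁ * n₀) : ℝ)| ≤ ((n₁ * n₀).divisors.card : ℝ) := by
        have := SieveSequence.abs_fiGamma_le j (n₁ * n₀)
        rw [ArithmeticFunction.sigma_zero_apply] at this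
        exact_mod_cast this
      have hμ : |(μ (n₁ * n₀) : ℝ)| ≤ 1 := by exact_mod_cast ArithmeticFunction.abs_moebius_le_one
      calc |(SieveSequence.fiGamma j (n₁ * n₀) : ℝ)| * |(μ (n₁ * n₀) : ℝ)| * A.a (k * (n₁ * n₀))
          ≤ ((n₁ * n₀).divisors.card : ℝ) * 1 * A.a (k * (n₁ * n₀)) := by
            gcongr; exact A.a_nonneg _
        _ = ((n₁ * n₀).divisors.card : ℝ) * A.a (k * (n₁ * n₀)) := by ring
    · rw [abs_zero]
      exact mul_nonneg (Nat.cast_nonneg _) (A.a_nonneg _)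

/-! ### The `j`-sum for a fixed smooth `n₁ ≤ Δ`: the factor `τ(n₁)` -/

variable {A : SieveSequence} in
/-- **Collapsing the `d₁`-sum** (FI §10: "change variables `t → td₁`"): for `n₁ ≥ 1` and any
finite set `R`, `k'`, `u`, `s`, with `G(q) = ∑_{n₀ ∈ R} [u < n₀ ≤ su] γ(n₀; q) μ(n₀) a_{k'n₀}`,
`∑_{1≤j<C₀} log((j+1)/j) ∑_{d₁ ∣ n₁} |G(⌊j/d₁⌋)| ≤ τ(n₁) ∑_{1≤q<C₀} log((q+1)/q) |G(q)|`
(`sum_Ico_log_mul_apply_div_le` for each `d₁`, using `G(0) = 0` as `γ(·; 0) = 0`).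
[cite: FriedlanderIwaniecASP1998, §10 p. 1065] -/
theorem sum_log_sum_divisors_abs_le (n₁ : ℕ) (R : Finset ℕ) (k' : ℕ) (u s : ℝ) (C₀ : ℕ) :
    ∑ j ∈ Ico 1 C₀, Real.log (((j : ℝ) + 1) / j) * ∑ d₁ ∈ n₁.divisors,
        |∑ n₀ ∈ R, (if u < (n₀ : ℝ) ∧ (n₀ : ℝ) ≤ s * u then
          (SieveSequence.fiGamma ((j / d₁ : ℕ) : ℝ) n₀ : ℝ) * (μ n₀ : ℝ) * A.a (k' * n₀) else 0)| ≤
      (n₁.divisors.card : ℝ) * ∑ q ∈ Ico 1 C₀, Real.log (((q : ℝ) + 1) / q) *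
        |∑ n₀ ∈ R, (if u < (n₀ : ℝ) ∧ (n₀ : ℝ) ≤ s * u then
          (SieveSequence.fiGamma (q : ℝ) n₀ : ℝ) * (μ n₀ : ℝ) * A.a (k' * n₀) else 0)| := by
  classical
  set F : ℕ → ℝ := fun q => |∑ n₀ ∈ R, (if u < (n₀ : ℝ) ∧ (n₀ : ℝ) ≤ s * u then
      (SieveSequence.fiGamma (q : ℝ) n₀ : ℝ) * (μ n₀ : ℝ) * A.a (k' * n₀) else 0)| with hF
  have hF0 : ∀ q, 0 ≤ F q := fun q => abs_nonneg _
  have hFz : F 0 = 0 := by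
    rw [hF]
    dsimp only
    rw [Finset.sum_eq_zero fun n₀ _ => ?_, abs_zero]
    rw [Nat.cast_zero, SieveSequence.fiGamma_of_lt_one zero_lt_one, Int.cast_zero, zero_mul,
      zero_mul, ite_self]
  -- swap the sums and apply the regrouping for each `d₁`
  calc ∑ j ∈ Ico 1 C₀, Real.log (((j : ℝ) + 1) / j) * ∑ d₁ ∈ n₁.divisors, F (j / d₁)
      = ∑ d₁ ∈ n₁.divisors, ∑ j ∈ Ico 1 C₀, Real.log (((j : ℝ) + 1) / j) * F (j / d₁) := by
        rw [Finset.sum_comm]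
        exact Finset.sum_congr rfl fun j _ => by rw [Finset.mul_sum]
    _ ≤ ∑ _d₁ ∈ n₁.divisors, ∑ q ∈ Ico 1 C₀, Real.log (((q : ℝ) + 1) / q) * F q := by
        refine Finset.sum_le_sum fun d₁ hd₁ => ?_
        exact sum_Ico_log_mul_apply_div_le (Nat.pos_of_mem_divisors hd₁) hF0 hFz
    _ = (n₁.divisors.card : ℝ) * ∑ q ∈ Ico 1 C₀, Real.log (((q : ℝ) + 1) / q) * F q := by
        rw [Finset.sum_const, nsmul_eq_mul]

/-! ### The terms with a large smooth part (`W₁`): Rankin's trick and the `τ⁶` moment -/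

variable {A : SieveSequence} in
/-- **`W₁` by Rankin's trick** (FI §10 (10.4): "Every such `n₁` has … by Rankin's trick. We choose
`ε = (log P)⁻¹`"): for `k, X`, `P > 1`, `Lw > 0`, with `ε = 1/log P`,
`∑_{n₁ > Lw} ∑_{n₀ rough} τ(n₁n₀) a_{kn₁n₀} ≤ Lw^{-ε} ∑_{c ≤ X/k} τ(c)³ a_{kc}` (`n₁` squarefree
`P`-smooth `≤ X/k`, `n₀` `P`-rough `≤ X/(kn₁)`): `1 ≤ Lw^{-ε} n₁^{ε} ≤ Lw^{-ε} e^{ω(n₁)} ≤ Lw^{-ε}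
τ(n₁)² ≤ Lw^{-ε} τ(n₁n₀)²`, then the decomposition `c = n₁n₀` backwards.
[cite: FriedlanderIwaniecASP1998, §10 (10.4) p. 1064] -/
theorem sum_large_smooth_le_rankin (h116 : ∀ n : ℕ, ¬Squarefree n → A.a n = 0) {P Lw : ℝ}
    (hP : 1 < P) (hLw : 0 < Lw) (k X : ℕ) :
    ∑ n₁ ∈ (Icc 1 (X / k)).filter (fun n : ℕ => Squarefree n ∧
        (∀ p ∈ n.primeFactors, (p : ℝ) < P) ∧ Lw < (n : ℝ)),
      ∑ n₀ ∈ (Icc 1 (X / (k * n₁))).filter (fun n : ℕ => ∀ p ∈ n.primeFactors, P ≤ (p : ℝ)),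
        (((n₁ * n₀).divisors.card : ℝ)) * A.a (k * n₁ * n₀) ≤
      Lw ^ (-(1 / Real.log P)) * ∑ c ∈ Icc 1 (X / k), ((c.divisors.card : ℝ)) ^ 3 * A.a (k * c) := by
  classical
  set ε : ℝ := 1 / Real.log P with hε
  have hε0 : 0 ≤ ε := by rw [hε]; exact div_nonneg zero_le_one (Real.log_nonneg hP.le)
  have hLε : 0 ≤ Lw ^ (-ε) := Real.rpow_nonneg hLw.le _
  set SM := (Icc 1 (X / k)).filter (fun n : ℕ => Squarefree n ∧ ∀ p ∈ n.primeFactors, (p : ℝ) < P)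
    with hSM
  set RO : ℕ → Finset ℕ := fun n₁ =>
    (Icc 1 (X / (k * n₁))).filter (fun n : ℕ => ∀ p ∈ n.primeFactors, P ≤ (p : ℝ)) with hRO
  set g : ℕ → ℝ := fun c => ((c.divisors.card : ℝ)) ^ 3 * A.a (k * c) with hg
  have hg0 : ∀ c, 0 ≤ g c := fun c => mul_nonneg (by positivity) (A.a_nonneg _)
  have hgsq : ∀ c, ¬Squarefree c → g c = 0 := by
    intro c hc
    have : ¬Squarefree (k * c) := fun h => hc (Squarefree.of_mul_right h)
    simp only [hg, h116 _ this, mul_zero]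
  -- the right-hand side via the decomposition
  have hdec : ∑ c ∈ Icc 1 (X / k), g c = ∑ n₁ ∈ SM, ∑ n₀ ∈ RO n₁, g (n₁ * n₀) := by
    rw [sum_Icc_eq_sum_sqfree_smooth_sum_rough P hgsq (X / k)]
    refine Finset.sum_congr rfl fun n₁ _ => ?_
    rw [hRO, Nat.div_div_eq_div_mul]
  rw [hdec, Finset.mul_sum]
  -- compare term by term over the subset `n₁ > Lw`
  have hsub : (Icc 1 (X / k)).filter (fun n : ℕ => Squarefree n ∧
      (∀ p ∈ n.primeFactors, (p : ℝ) < P) ∧ Lw < (n : ℝ)) ⊆ SM := by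
    intro n hn
    obtain ⟨hI, hsq, hsm, -⟩ := Finset.mem_filter.mp hn
    exact Finset.mem_filter.mpr ⟨hI, hsq, hsm⟩
  refine le_trans ?_ (Finset.sum_le_sum_of_subset_of_nonneg hsub fun n₁ _ _ =>
    mul_nonneg hLε (Finset.sum_nonneg fun n₀ _ => hg0 _))
  refine Finset.sum_le_sum fun n₁ hn₁ => ?_
  obtain ⟨hI, hsq, hsm, hbig⟩ := Finset.mem_filter.mp hn₁
  rw [Finset.mul_sum]
  refine Finset.sum_le_sum fun n₀ hn₀ => ?_
  have hn₀0 : n₀ ≠ 0 := Nat.one_le_iff_ne_zero.mp (Finset.mem_Icc.mp (Finset.mem_filter.mp hn₀).1).1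
  -- Rankin: `1 ≤ Lw^{-ε} τ(n₁)² ≤ Lw^{-ε} τ(n₁ n₀)²`
  have h1 : (1 : ℝ) ≤ Lw ^ (-ε) * ((n₁.divisors.card : ℝ)) ^ 2 := by
    calc (1 : ℝ) ≤ Lw ^ (-ε) * (n₁ : ℝ) ^ ε := one_le_rpow_neg_mul_rpow hLw hε0 hbig
      _ ≤ Lw ^ (-ε) * Real.exp n₁.primeFactors.card :=
          mul_le_mul_of_nonneg_left (rpow_inv_log_le_exp_card_primeFactors hP hsq hsm) hLε
      _ ≤ Lw ^ (-ε) * ((n₁.divisors.card : ℝ)) ^ 2 :=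
          mul_le_mul_of_nonneg_left (exp_card_primeFactors_le_card_divisors_sq hsq) hLε
  have hτ : (n₁.divisors.card : ℝ) ≤ ((n₁ * n₀).divisors.card : ℝ) := by
    exact_mod_cast Finset.card_le_card
      (Nat.divisors_subset_of_dvd (mul_ne_zero hsq.ne_zero hn₀0) (Dvd.intro n₀ rfl))
  have hτ0 : (0 : ℝ) ≤ (n₁.divisors.card : ℝ) := Nat.cast_nonneg _
  simp only [hg]
  rw [mul_assoc k n₁ n₀]
  set a := A.a (k * (n₁ * n₀)) with ha
  have ha0 : 0 ≤ a := A.a_nonneg _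
  set τ := (((n₁ * n₀).divisors.card : ℝ)) with hτdef
  calc τ * a = 1 * (τ * a) := (one_mul _).symm
    _ ≤ (Lw ^ (-ε) * ((n₁.divisors.card : ℝ)) ^ 2) * (τ * a) :=
        mul_le_mul_of_nonneg_right h1 (mul_nonneg (hτ0.trans hτ) ha0)
    _ ≤ (Lw ^ (-ε) * τ ^ 2) * (τ * a) := by
        refine mul_le_mul_of_nonneg_right (mul_le_mul_of_nonneg_left
          (pow_le_pow_left₀ hτ0 hτ 2) hLε) (mul_nonneg (hτ0.trans hτ) ha0)
    _ = Lw ^ (-ε) * (τ ^ 3 * a) := by ring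

variable {A : SieveSequence} in
/-- **Gathering the `k`-sum into the sixth divisor moment**: `∑_{k≤X} τ(k)² ∑_{c≤X/k} τ(c)³ a_{kc}
≤ ∑_{n≤X} a_n τ(n)⁶` (`τ(k), τ(c) ≤ τ(kc)`, and `kc = n` has `τ(n)` solutions).
[cite: FriedlanderIwaniecASP1998, §10 (10.4)] -/
theorem sum_tau_sq_sum_tau_cube_le (X : ℕ) :
    ∑ k ∈ Icc 1 X, ((k.divisors.card : ℝ)) ^ 2 * ∑ c ∈ Icc 1 (X / k),
        ((c.divisors.card : ℝ)) ^ 3 * A.a (k * c) ≤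
      ∑ n ∈ Ioc 0 X, A.a n * ((n.divisors.card : ℝ)) ^ 6 := by
  classical
  calc ∑ k ∈ Icc 1 X, ((k.divisors.card : ℝ)) ^ 2 * ∑ c ∈ Icc 1 (X / k),
        ((c.divisors.card : ℝ)) ^ 3 * A.a (k * c)
      = ∑ k ∈ Icc 1 X, ∑ c ∈ Icc 1 (X / k),
          ((k.divisors.card : ℝ)) ^ 2 * ((c.divisors.card : ℝ)) ^ 3 * A.a (k * c) := by
        refine Finset.sum_congr rfl fun k _ => ?_
        rw [Finset.mul_sum]
        exact Finset.sum_congr rfl fun c _ => by ring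
    _ ≤ ∑ n ∈ Ioc 0 X, ∑ p ∈ n.divisorsAntidiagonal,
          ((p.1.divisors.card : ℝ)) ^ 2 * ((p.2.divisors.card : ℝ)) ^ 3 * A.a (p.1 * p.2) := by
        refine sum_sum_le_sum_divisorsAntidiagonal (f := fun k c =>
          ((k.divisors.card : ℝ)) ^ 2 * ((c.divisors.card : ℝ)) ^ 3 * A.a (k * c))
          (fun k c => mul_nonneg (by positivity) (A.a_nonneg _)) X (Icc 1 X) (fun k => Icc 1 (X / k))
          fun k hk c hc => ?_
        obtain ⟨hk1, -⟩ := Finset.mem_Icc.mp hk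
        obtain ⟨hc1, hcX⟩ := Finset.mem_Icc.mp hc
        refine ⟨hk1, hc1, ?_⟩
        have := (Nat.le_div_iff_mul_le hk1).mp hcX
        rw [mul_comm] at this
        exact this
    _ ≤ ∑ n ∈ Ioc 0 X, A.a n * ((n.divisors.card : ℝ)) ^ 6 := by
        refine Finset.sum_le_sum fun n hn => ?_
        have hn0 : n ≠ 0 := (Finset.mem_Ioc.mp hn).1.ne'
        have hterm : ∀ p ∈ n.divisorsAntidiagonal,
            ((p.1.divisors.card : ℝ)) ^ 2 * ((p.2.divisors.card : ℝ)) ^ 3 * A.a (p.1 * p.2) ≤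
              ((n.divisors.card : ℝ)) ^ 5 * A.a n := by
          intro p hp
          obtain ⟨hpn, -⟩ := Nat.mem_divisorsAntidiagonal.mp hp
          have h1 : (p.1.divisors.card : ℝ) ≤ (n.divisors.card : ℝ) := by
            exact_mod_cast Finset.card_le_card (Nat.divisors_subset_of_dvd hn0 ⟨p.2, hpn.symm⟩)
          have h2 : (p.2.divisors.card : ℝ) ≤ (n.divisors.card : ℝ) := by
            exact_mod_cast Finset.card_le_card
              (Nat.divisors_subset_of_dvd hn0 ⟨p.1, by rw [mul_comm]; exact hpn.symm⟩)
          rw [hpn]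
          calc ((p.1.divisors.card : ℝ)) ^ 2 * ((p.2.divisors.card : ℝ)) ^ 3 * A.a n
              ≤ ((n.divisors.card : ℝ)) ^ 2 * ((n.divisors.card : ℝ)) ^ 3 * A.a n := by
                gcongr
                exact A.a_nonneg n
            _ = ((n.divisors.card : ℝ)) ^ 5 * A.a n := by ring
        calc ∑ p ∈ n.divisorsAntidiagonal,
              ((p.1.divisors.card : ℝ)) ^ 2 * ((p.2.divisors.card : ℝ)) ^ 3 * A.a (p.1 * p.2)
            ≤ ∑ _p ∈ n.divisorsAntidiagonal, ((n.divisors.card : ℝ)) ^ 5 * A.a n :=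
              Finset.sum_le_sum hterm
          _ = (n.divisorsAntidiagonal.card : ℝ) * (((n.divisors.card : ℝ)) ^ 5 * A.a n) := by
              rw [Finset.sum_const, nsmul_eq_mul]
          _ = A.a n * ((n.divisors.card : ℝ)) ^ 6 := by
              rw [← Nat.map_div_right_divisors, Finset.card_map]
              ring

/-! ### Reindexing `ℓ = k n₁`: the weight `6^{ω(ℓ)}` -/

/-- For squarefree `ℓ`, `∑_{kn = ℓ} τ(k)² τ(n) = 6^{ω(ℓ)}` (`τ(k)² = 4^{ω(k)} = τ₄(k)` on squarefree `k`,
`τ₄ ∗ τ₂ = τ₆`). [folklore] -/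
theorem sum_divisorsAntidiagonal_card_divisors_sq_mul_card_divisors {ℓ : ℕ} (hℓ : Squarefree ℓ) :
    ∑ p ∈ ℓ.divisorsAntidiagonal, ((p.1.divisors.card : ℝ)) ^ 2 * (p.2.divisors.card : ℝ) =
      (6 : ℝ) ^ ℓ.primeFactors.card := by
  have hmul : divisorCountK 4 * divisorCountK 2 = divisorCountK 6 := by
    rw [divisorCountK, divisorCountK, divisorCountK, ← pow_add]
  have happ := congrArg (fun f : ArithmeticFunction ℕ => (f ℓ : ℕ)) hmul
  simp only [ArithmeticFunction.mul_apply] at happ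
  rw [divisorCountK_apply_of_squarefree 6 hℓ] at happ
  have hcast : ∑ p ∈ ℓ.divisorsAntidiagonal, ((p.1.divisors.card : ℝ)) ^ 2 * (p.2.divisors.card : ℝ) =
      ((6 ^ ω ℓ : ℕ) : ℝ) := by
    rw [← happ]
    push_cast
    refine Finset.sum_congr rfl fun p hp => ?_
    have hp1 : p.1 ∣ ℓ := Nat.fst_mem_divisors_of_mem_antidiagonal hp |> Nat.dvd_of_mem_divisors
    have hsq1 : Squarefree p.1 := hℓ.squarefree_of_dvd hp1
    rw [divisorCountK_apply_of_squarefree 4 hsq1, card_divisors_of_squarefree hsq1,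
      ← card_primeFactors_eq_cardDistinctFactors]
    have h2 := congrArg (fun f : ArithmeticFunction ℕ => f p.2) divisorCountK_two
    simp only [ArithmeticFunction.sigma_zero_apply] at h2
    rw [h2]
    push_cast
    rw [show (4 : ℝ) ^ p.1.primeFactors.card = ((2 : ℝ) ^ p.1.primeFactors.card) ^ 2 by
      rw [← pow_mul, mul_comm, pow_mul]; norm_num]
  rw [hcast, ← card_primeFactors_eq_cardDistinctFactors]
  push_cast
  ring

/-- **Reindexing by `ℓ = k n₁`** (FI §10: "change variables … `w → w n₁` getting
`∑_m τ₃(m)|…|`", here with the weight `τ(k)²` of (8.1), which becomes `6^{ω(ℓ)}`): for `J ≥ 0`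
vanishing off the squarefree integers and any side condition `Q` on `n₁`,
`∑_{k≤X} τ(k)² ∑_{n₁ ≤ X/k, Q(n₁)} τ(n₁) J(kn₁) ≤ ∑_{ℓ≤X} 6^{ω(ℓ)} J(ℓ)`.
[cite: FriedlanderIwaniecASP1998, §10 p. 1065] -/
theorem sum_tau_sq_sum_tau_mul_le {J : ℕ → ℝ} (hJ0 : ∀ ℓ, 0 ≤ J ℓ)
    (hJsq : ∀ ℓ, ¬Squarefree ℓ → J ℓ = 0) (X : ℕ) (Q : ℕ → Prop) [DecidablePred Q] :
    ∑ k ∈ Icc 1 X, ((k.divisors.card : ℝ)) ^ 2 *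
        ∑ n₁ ∈ (Icc 1 (X / k)).filter Q, (n₁.divisors.card : ℝ) * J (k * n₁) ≤
      ∑ ℓ ∈ Icc 1 X, (6 : ℝ) ^ ℓ.primeFactors.card * J ℓ := by
  classical
  calc ∑ k ∈ Icc 1 X, ((k.divisors.card : ℝ)) ^ 2 *
        ∑ n₁ ∈ (Icc 1 (X / k)).filter Q, (n₁.divisors.card : ℝ) * J (k * n₁)
      ≤ ∑ k ∈ Icc 1 X, ∑ n₁ ∈ Icc 1 (X / k),
          ((k.divisors.card : ℝ)) ^ 2 * (n₁.divisors.card : ℝ) * J (k * n₁) := by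
        refine Finset.sum_le_sum fun k _ => ?_
        rw [Finset.mul_sum]
        calc ∑ n₁ ∈ (Icc 1 (X / k)).filter Q, ((k.divisors.card : ℝ)) ^ 2 * ((n₁.divisors.card : ℝ) * J (k * n₁))
            ≤ ∑ n₁ ∈ Icc 1 (X / k), ((k.divisors.card : ℝ)) ^ 2 * ((n₁.divisors.card : ℝ) * J (k * n₁)) :=
              Finset.sum_le_sum_of_subset_of_nonneg (Finset.filter_subset _ _) fun n₁ _ _ =>
                mul_nonneg (by positivity) (mul_nonneg (Nat.cast_nonneg _) (hJ0 _))
          _ = _ := Finset.sum_congr rfl fun n₁ _ => by ring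
    _ ≤ ∑ ℓ ∈ Ioc 0 X, ∑ p ∈ ℓ.divisorsAntidiagonal,
          ((p.1.divisors.card : ℝ)) ^ 2 * (p.2.divisors.card : ℝ) * J (p.1 * p.2) := by
        refine sum_sum_le_sum_divisorsAntidiagonal (f := fun k n₁ =>
          ((k.divisors.card : ℝ)) ^ 2 * (n₁.divisors.card : ℝ) * J (k * n₁))
          (fun k n₁ => mul_nonneg (by positivity) (hJ0 _)) X (Icc 1 X) (fun k => Icc 1 (X / k))
          fun k hk n₁ hn₁ => ?_
        obtain ⟨hk1, -⟩ := Finset.mem_Icc.mp hk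
        obtain ⟨hn1, hnX⟩ := Finset.mem_Icc.mp hn₁
        refine ⟨hk1, hn1, ?_⟩
        have := (Nat.le_div_iff_mul_le hk1).mp hnX
        rw [mul_comm] at this
        exact this
    _ ≤ ∑ ℓ ∈ Ioc 0 X, (6 : ℝ) ^ ℓ.primeFactors.card * J ℓ := by
        refine Finset.sum_le_sum fun ℓ _ => ?_
        have heq : ∑ p ∈ ℓ.divisorsAntidiagonal,
            ((p.1.divisors.card : ℝ)) ^ 2 * (p.2.divisors.card : ℝ) * J (p.1 * p.2) =
            (∑ p ∈ ℓ.divisorsAntidiagonal, ((p.1.divisors.card : ℝ)) ^ 2 * (p.2.divisors.card : ℝ)) * J ℓ := by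
          rw [Finset.sum_mul]
          refine Finset.sum_congr rfl fun p hp => ?_
          rw [(Nat.mem_divisorsAntidiagonal.mp hp).1]
        rw [heq]
        by_cases hsq : Squarefree ℓ
        · rw [sum_divisorsAntidiagonal_card_divisors_sq_mul_card_divisors hsq]
        · rw [hJsq ℓ hsq, mul_zero, mul_zero]
    _ = ∑ ℓ ∈ Icc 1 X, (6 : ℝ) ^ ℓ.primeFactors.card * J ℓ := by
        rw [show Ioc 0 X = Icc 1 X from (Finset.Icc_succ_left_eq_Ioc 0 X).symm]

/-! ### The rough inner sums on the dyadic pieces: the form of (B*) -/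

variable {A : SieveSequence} in
/-- **Dyadic pieces of the rough inner sum** (FI §7/§8: (B′) "applied `log₂ s` times"; §10: "the
restriction `(n, Π) = 1` only helps matters"): for `ℓ ≥ 1`, `u, x ≥ 0`, `s = 2^{k₀}`, under (1.16),
`|∑_{n₀ ≤ x/ℓ rough, u<n₀≤su} γ(n₀;q) μ(n₀) a_{ℓn₀}| ≤ ∑_{i<k₀} |∑_{2^iu<n≤2^{i+1}u, ℓn≤x, n rough}
γ(n;q) μ(ℓn) a_{ℓn}|`, the pieces being the inner sums of `fiBilinearRough` at `N = 2^i u`.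
[cite: FriedlanderIwaniecASP1998, §10 p. 1065] -/
theorem abs_rough_inner_le_sum_pieces (h116 : ∀ n : ℕ, ¬Squarefree n → A.a n = 0) (P : ℝ)
    {x : ℝ} (hx : 0 ≤ x) {u : ℝ} (hu : 0 ≤ u) (k₀ : ℕ) {ℓ : ℕ} (hℓ : 1 ≤ ℓ) (q : ℝ) :
    |∑ n₀ ∈ (Icc 1 (⌊x⌋₊ / ℓ)).filter (fun n : ℕ => ∀ p ∈ n.primeFactors, P ≤ (p : ℝ)),
        (if u < (n₀ : ℝ) ∧ (n₀ : ℝ) ≤ 2 ^ k₀ * u then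
          (SieveSequence.fiGamma q n₀ : ℝ) * (μ n₀ : ℝ) * A.a (ℓ * n₀) else 0)| ≤
      ∑ i ∈ range k₀, |∑ n ∈ (Ioc ⌊2 ^ i * u⌋₊ ⌊2 * (2 ^ i * u)⌋₊).filter
          (fun n : ℕ => ((ℓ * n : ℕ) : ℝ) ≤ x ∧ ∀ p ∈ n.primeFactors, P ≤ (p : ℝ)),
        (SieveSequence.fiGamma q n : ℝ) * (μ (ℓ * n) : ℝ) * A.a (ℓ * n)| := by
  classical
  set c : ℕ → ℝ := fun n => if (∀ p ∈ n.primeFactors, P ≤ (p : ℝ)) then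
      (SieveSequence.fiGamma q n : ℝ) * (μ n : ℝ) * A.a (ℓ * n) else 0 with hc
  -- move the roughness filter inside
  have h1 : ∑ n₀ ∈ (Icc 1 (⌊x⌋₊ / ℓ)).filter (fun n : ℕ => ∀ p ∈ n.primeFactors, P ≤ (p : ℝ)),
        (if u < (n₀ : ℝ) ∧ (n₀ : ℝ) ≤ 2 ^ k₀ * u then
          (SieveSequence.fiGamma q n₀ : ℝ) * (μ n₀ : ℝ) * A.a (ℓ * n₀) else 0) =
      ∑ n₀ ∈ Icc 1 (⌊x⌋₊ / ℓ), (if u < (n₀ : ℝ) ∧ (n₀ : ℝ) ≤ 2 ^ k₀ * u then c n₀ else 0) := by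
    rw [Finset.sum_filter]
    refine Finset.sum_congr rfl fun n₀ _ => ?_
    simp only [hc]
    split_ifs <;> rfl
  rw [h1, sum_ite_Ioc_pow_eq_sum_range c hu k₀ hx hℓ]
  refine (Finset.abs_sum_le_sum_abs _ _).trans (Finset.sum_le_sum fun i _ => ?_)
  -- each piece: reinstate the filter and use `μ(n) a_{ℓn} = μ(ℓ) μ(ℓn) a_{ℓn}`
  have h2 : ∑ n ∈ (Ioc ⌊2 ^ i * u⌋₊ ⌊2 * (2 ^ i * u)⌋₊).filter (fun n : ℕ => ((ℓ * n : ℕ) : ℝ) ≤ x), c n =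
      ∑ n ∈ (Ioc ⌊2 ^ i * u⌋₊ ⌊2 * (2 ^ i * u)⌋₊).filter
          (fun n : ℕ => ((ℓ * n : ℕ) : ℝ) ≤ x ∧ ∀ p ∈ n.primeFactors, P ≤ (p : ℝ)),
        (SieveSequence.fiGamma q n : ℝ) * (μ n : ℝ) * A.a (ℓ * n) := by
    symm
    rw [← Finset.filter_filter, Finset.sum_filter]
  rw [h2, sum_gamma_moebius_mul_a_eq h116 ℓ q, abs_mul]
  have hμ : |(μ ℓ : ℝ)| ≤ 1 := by exact_mod_cast ArithmeticFunction.abs_moebius_le_one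
  calc |(μ ℓ : ℝ)| * _ ≤ 1 * _ := mul_le_mul_of_nonneg_right hμ (abs_nonneg _)
    _ = _ := one_mul _

variable {A : SieveSequence} in
/-- **The reduced sieved bilinear bound on the pieces**: if every dyadic piece `N = 2^i u`, `i < k₀`,
satisfies `∑_ℓ 6^{ω(ℓ)} |∑_{N<n≤2N, ℓn≤x, n rough} γ(n;q) μ(ℓn) a_{ℓn}| ≤ K_B`, then
`∑_{ℓ≤x} 6^{ω(ℓ)} |∑_{n₀ ≤ x/ℓ rough, u<n₀≤2^{k₀}u} γ(n₀;q) μ(n₀) a_{ℓn₀}| ≤ k₀ K_B`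
(compare `sum_tau3_abs_inner_le`). [cite: FriedlanderIwaniecASP1998, §10 (10.5)] -/
theorem sum_six_pow_abs_rough_inner_le (h116 : ∀ n : ℕ, ¬Squarefree n → A.a n = 0) (P : ℝ)
    {x : ℝ} (hx : 0 ≤ x) {u : ℝ} (hu : 0 ≤ u) (k₀ : ℕ) (q : ℝ) {KB : ℝ}
    (hB : ∀ i ∈ range k₀, ∑ m ∈ Icc 1 ⌊x⌋₊, (6 : ℝ) ^ m.primeFactors.card *
      |∑ n ∈ (Ioc ⌊2 ^ i * u⌋₊ ⌊2 * (2 ^ i * u)⌋₊).filter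
          (fun n : ℕ => ((m * n : ℕ) : ℝ) ≤ x ∧ ∀ p ∈ n.primeFactors, P ≤ (p : ℝ)),
        (SieveSequence.fiGamma q n : ℝ) * (μ (m * n) : ℝ) * A.a (m * n)| ≤ KB) :
    ∑ ℓ ∈ Icc 1 ⌊x⌋₊, (6 : ℝ) ^ ℓ.primeFactors.card *
        |∑ n₀ ∈ (Icc 1 (⌊x⌋₊ / ℓ)).filter (fun n : ℕ => ∀ p ∈ n.primeFactors, P ≤ (p : ℝ)),
          (if u < (n₀ : ℝ) ∧ (n₀ : ℝ) ≤ 2 ^ k₀ * u then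
            (SieveSequence.fiGamma q n₀ : ℝ) * (μ n₀ : ℝ) * A.a (ℓ * n₀) else 0)| ≤ k₀ * KB := by
  classical
  set T : ℕ → ℕ → ℝ := fun i m =>
    |∑ n ∈ (Ioc ⌊2 ^ i * u⌋₊ ⌊2 * (2 ^ i * u)⌋₊).filter
        (fun n : ℕ => ((m * n : ℕ) : ℝ) ≤ x ∧ ∀ p ∈ n.primeFactors, P ≤ (p : ℝ)),
      (SieveSequence.fiGamma q n : ℝ) * (μ (m * n) : ℝ) * A.a (m * n)| with hT
  calc ∑ ℓ ∈ Icc 1 ⌊x⌋₊, (6 : ℝ) ^ ℓ.primeFactors.card *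
        |∑ n₀ ∈ (Icc 1 (⌊x⌋₊ / ℓ)).filter (fun n : ℕ => ∀ p ∈ n.primeFactors, P ≤ (p : ℝ)),
          (if u < (n₀ : ℝ) ∧ (n₀ : ℝ) ≤ 2 ^ k₀ * u then
            (SieveSequence.fiGamma q n₀ : ℝ) * (μ n₀ : ℝ) * A.a (ℓ * n₀) else 0)|
      ≤ ∑ ℓ ∈ Icc 1 ⌊x⌋₊, (6 : ℝ) ^ ℓ.primeFactors.card * ∑ i ∈ range k₀, T i ℓ := by
        refine Finset.sum_le_sum fun ℓ hℓ => ?_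
        exact mul_le_mul_of_nonneg_left
          (abs_rough_inner_le_sum_pieces h116 P hx hu k₀ (Finset.mem_Icc.mp hℓ).1 q) (by positivity)
    _ = ∑ i ∈ range k₀, ∑ ℓ ∈ Icc 1 ⌊x⌋₊, (6 : ℝ) ^ ℓ.primeFactors.card * T i ℓ := by
        rw [Finset.sum_comm]
        exact Finset.sum_congr rfl fun ℓ _ => by rw [Finset.mul_sum]
    _ ≤ ∑ i ∈ range k₀, KB := Finset.sum_le_sum fun i hi => hB i hi
    _ = k₀ * KB := by rw [Finset.sum_const, Finset.card_range, nsmul_eq_mul]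

/-! ### Numerics of (10.2): `Δ^{-1/log P} ≤ (log x)^{-2^{33}}`; measurability of the window sums -/

/-- **The saving of Rankin's trick under (10.2)** (FI §10: "`G₂ ≤ Δ^{-ε} ∏_{p<P}(1 + 2⁸p^{ε-1})` …
`= exp(-log Δ/log P + …) ≪ (log x)^{-2^{34}}`"): if `2 ≤ P ≤ (x^{2θ})^{1/(2^{35} log log x)}` with
`θ > 0` and `log log x > 0`, then `(x^{θ/2})^{-1/log P} ≤ (log x)^{-2^{33}}`
(`log(x^{θ/2})/log P ≥ (θ/2) log x · 2^{35} log log x/(2θ log x) = 2^{33} log log x`).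
[cite: FriedlanderIwaniecASP1998, §10 (10.2) and (10.4)] -/
theorem rankin_rpow_le_log_rpow {x θ P : ℝ} (hx : 1 < x) (hll : 0 < Real.log (Real.log x))
    (hθ : 0 < θ) (hP2 : 2 ≤ P) (hP : P ≤ (x ^ (2 * θ)) ^ (1 / (2 ^ 35 * Real.log (Real.log x)))) :
    (x ^ (θ / 2)) ^ (-(1 / Real.log P)) ≤ Real.log x ^ (-(2 ^ 33 : ℝ)) := by
  have hx0 : 0 < x := by linarith
  have hlogx : 0 < Real.log x := Real.log_pos hx
  have hP0 : 0 < P := by linarith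
  have hlogP : 0 < Real.log P := Real.log_pos (by linarith)
  set LL := Real.log (Real.log x) with hLL
  -- `log P ≤ 2θ log x / (2^35 LL)`
  have hlogP_le : Real.log P ≤ 2 * θ * Real.log x / (2 ^ 35 * LL) := by
    have h1 := Real.log_le_log hP0 hP
    rw [Real.log_rpow (Real.rpow_pos_of_pos hx0 _), Real.log_rpow hx0] at h1
    calc Real.log P ≤ 1 / (2 ^ 35 * LL) * (2 * θ * Real.log x) := h1
      _ = 2 * θ * Real.log x / (2 ^ 35 * LL) := by ring
  -- the exponent
  have hexp : Real.log (x ^ (θ / 2)) * (-(1 / Real.log P)) ≤ LL * (-(2 ^ 33 : ℝ)) := by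
    rw [Real.log_rpow hx0]
    have hkey : (2 : ℝ) ^ 33 * LL * Real.log P ≤ θ / 2 * Real.log x := by
      calc (2 : ℝ) ^ 33 * LL * Real.log P ≤ (2 : ℝ) ^ 33 * LL * (2 * θ * Real.log x / (2 ^ 35 * LL)) :=
            mul_le_mul_of_nonneg_left hlogP_le (by positivity)
        _ = θ / 2 * Real.log x := by field_simp
    rw [show θ / 2 * Real.log x * (-(1 / Real.log P)) = -(θ / 2 * Real.log x / Real.log P) by ring,
      show LL * (-(2 ^ 33 : ℝ)) = -((2 : ℝ) ^ 33 * LL) by ring, neg_le_neg_iff,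
      le_div_iff₀ hlogP]
    exact hkey
  rw [Real.rpow_def_of_pos (Real.rpow_pos_of_pos hx0 _), Real.rpow_def_of_pos hlogx]
  exact Real.exp_le_exp.mpr hexp

/-- `u ↦ ∑_{b ∈ S} [u < b ≤ su] c(b)` is measurable. [folklore] -/
theorem measurable_window_sum (S : Finset ℕ) (c : ℕ → ℝ) (s : ℝ) :
    Measurable fun u : ℝ => ∑ b ∈ S, (if u < (b : ℝ) ∧ (b : ℝ) ≤ s * u then c b else 0) := by
  refine Finset.measurable_sum _ fun b _ => ?_
  refine Measurable.ite ?_ measurable_const measurable_const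
  exact (measurableSet_lt measurable_id measurable_const).inter
    (measurableSet_le measurable_const (measurable_id.const_mul s))

/-- `|∑_{b ∈ S} [u < b ≤ su] c(b)| ≤ ∑_{b ∈ S} |c(b)|`. [folklore] -/
theorem abs_window_sum_le (S : Finset ℕ) (c : ℕ → ℝ) (s u : ℝ) :
    |∑ b ∈ S, (if u < (b : ℝ) ∧ (b : ℝ) ≤ s * u then c b else 0)| ≤ ∑ b ∈ S, |c b| := by
  refine (Finset.abs_sum_le_sum_abs _ _).trans (Finset.sum_le_sum fun b _ => ?_)
  split_ifs
  · exact le_rfl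
  · rw [abs_zero]; exact abs_nonneg _

/-! ### The weighted `T`-sum at a fixed `z`: `W₀(z) + W₁` -/

variable {A : SieveSequence} in
/-- **The `λ⁻`-weighted sum of (8.1) at a fixed `z`, after §10** (combining
`abs_T_le_smooth_add_large`, `sum_log_sum_divisors_abs_le`, `sum_large_smooth_le_rankin`,
`sum_tau_sq_sum_tau_cube_le` and `∑_{j<C₀} log((j+1)/j) = log C₀`): with `ε = 1/log P`,
`∑_{j<C₀} log((j+1)/j) ∑_{k≤X} τ(k)² |T_j(k, z)| ≤ W₀(z) + log C₀ · Lw^{-ε} ∑_{n≤X} a_n τ(n)⁶`, where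
`W₀(z) = ∑_{k≤X} τ(k)² ∑_{n₁ ≤ Lw} τ(n₁) ∑_{q<C₀} log((q+1)/q) |∑_{n₀ rough} [z/n₁<n₀≤sz/n₁]
γ(n₀;q) μ(n₀) a_{kn₁n₀}|`. [cite: FriedlanderIwaniecASP1998, §10 pp. 1064-1065] -/
theorem weighted_T_sum_le (h116 : ∀ n : ℕ, ¬Squarefree n → A.a n = 0) {P Lw : ℝ} (hP : 1 < P)
    (hLw : 0 < Lw) (X : ℕ) (z s : ℝ) {C₀ : ℕ} (hC : 1 ≤ C₀) :
    ∑ j ∈ Ico 1 C₀, Real.log (((j : ℝ) + 1) / j) *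
        ∑ k ∈ Icc 1 X, ((k.divisors.card : ℝ)) ^ 2 *
          |∑ c ∈ Icc 1 (X / k), (if z < (c : ℝ) ∧ (c : ℝ) ≤ s * z then
              (SieveSequence.fiGamma j c : ℝ) * (μ c : ℝ) * A.a (k * c) else 0)| ≤
      (∑ k ∈ Icc 1 X, ((k.divisors.card : ℝ)) ^ 2 *
        ∑ n₁ ∈ (Icc 1 (X / k)).filter (fun n : ℕ => Squarefree n ∧
            (∀ p ∈ n.primeFactors, (p : ℝ) < P) ∧ (n : ℝ) ≤ Lw),
          (n₁.divisors.card : ℝ) * ∑ q ∈ Ico 1 C₀, Real.log (((q : ℝ) + 1) / q) *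
            |∑ n₀ ∈ (Icc 1 (X / (k * n₁))).filter (fun n : ℕ => ∀ p ∈ n.primeFactors, P ≤ (p : ℝ)),
              (if z / n₁ < (n₀ : ℝ) ∧ (n₀ : ℝ) ≤ s * (z / n₁) then
                (SieveSequence.fiGamma (q : ℝ) n₀ : ℝ) * (μ n₀ : ℝ) * A.a (k * n₁ * n₀) else 0)|) +
      Real.log C₀ * ((Lw ^ (-(1 / Real.log P))) *
        ∑ n ∈ Ioc 0 X, A.a n * ((n.divisors.card : ℝ)) ^ 6) := by
  classical
  set w : ℕ → ℝ := fun j => Real.log (((j : ℝ) + 1) / j) with hw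
  have hw0 : ∀ j ∈ Ico 1 C₀, 0 ≤ w j := fun j hj => log_succ_div_nonneg (Finset.mem_Ico.mp hj).1
  have hwsum : ∑ j ∈ Ico 1 C₀, w j = Real.log C₀ := by
    have h := sum_Ico_log_succ_div 1 C₀ le_rfl hC
    simp only [Nat.cast_one, Real.log_one, sub_zero] at h
    exact h
  -- names for the pieces
  set SMle : ℕ → Finset ℕ := fun k => (Icc 1 (X / k)).filter (fun n : ℕ => Squarefree n ∧
      (∀ p ∈ n.primeFactors, (p : ℝ) < P) ∧ (n : ℝ) ≤ Lw) with hSMle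
  set SMgt : ℕ → Finset ℕ := fun k => (Icc 1 (X / k)).filter (fun n : ℕ => Squarefree n ∧
      (∀ p ∈ n.primeFactors, (p : ℝ) < P) ∧ Lw < (n : ℝ)) with hSMgt
  set RO : ℕ → Finset ℕ := fun ℓ =>
    (Icc 1 (X / ℓ)).filter (fun n : ℕ => ∀ p ∈ n.primeFactors, P ≤ (p : ℝ)) with hRO
  set G : ℕ → ℕ → ℕ → ℝ := fun k n₁ q =>
    |∑ n₀ ∈ RO (k * n₁), (if z / n₁ < (n₀ : ℝ) ∧ (n₀ : ℝ) ≤ s * (z / n₁) then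
      (SieveSequence.fiGamma (q : ℝ) n₀ : ℝ) * (μ n₀ : ℝ) * A.a (k * n₁ * n₀) else 0)| with hG
  set W0 : ℕ → ℕ → ℝ := fun j k => ∑ n₁ ∈ SMle k, ∑ d₁ ∈ n₁.divisors, G k n₁ (j / d₁) with hW0
  set W1 : ℕ → ℝ := fun k => ∑ n₁ ∈ SMgt k, ∑ n₀ ∈ RO (k * n₁),
      (((n₁ * n₀).divisors.card : ℝ)) * A.a (k * n₁ * n₀) with hW1
  -- Step 1: `|T_j(k)| ≤ W0 j k + W1 k`
  have hT : ∀ j k : ℕ, |∑ c ∈ Icc 1 (X / k), (if z < (c : ℝ) ∧ (c : ℝ) ≤ s * z then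
      (SieveSequence.fiGamma j c : ℝ) * (μ c : ℝ) * A.a (k * c) else 0)| ≤ W0 j k + W1 k := by
    intro j k
    exact abs_T_le_smooth_add_large (A := A) P Lw k j X z s
  -- Step 2: sum with the weights
  have hW00 : ∀ j k, 0 ≤ W0 j k := fun j k =>
    Finset.sum_nonneg fun _ _ => Finset.sum_nonneg fun _ _ => abs_nonneg _
  have hW10 : ∀ k, 0 ≤ W1 k := fun k =>
    Finset.sum_nonneg fun _ _ => Finset.sum_nonneg fun _ _ => mul_nonneg (Nat.cast_nonneg _) (A.a_nonneg _)
  calc ∑ j ∈ Ico 1 C₀, w j * ∑ k ∈ Icc 1 X, ((k.divisors.card : ℝ)) ^ 2 *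
          |∑ c ∈ Icc 1 (X / k), (if z < (c : ℝ) ∧ (c : ℝ) ≤ s * z then
              (SieveSequence.fiGamma j c : ℝ) * (μ c : ℝ) * A.a (k * c) else 0)|
      ≤ ∑ j ∈ Ico 1 C₀, w j * ∑ k ∈ Icc 1 X, ((k.divisors.card : ℝ)) ^ 2 * (W0 j k + W1 k) := by
        refine Finset.sum_le_sum fun j hj => mul_le_mul_of_nonneg_left
          (Finset.sum_le_sum fun k _ => mul_le_mul_of_nonneg_left (hT j k) (by positivity)) (hw0 j hj)
    _ = (∑ j ∈ Ico 1 C₀, ∑ k ∈ Icc 1 X, w j * (((k.divisors.card : ℝ)) ^ 2 * W0 j k)) +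
          ∑ j ∈ Ico 1 C₀, w j * ∑ k ∈ Icc 1 X, ((k.divisors.card : ℝ)) ^ 2 * W1 k := by
        rw [← Finset.sum_add_distrib]
        refine Finset.sum_congr rfl fun j _ => ?_
        rw [← Finset.mul_sum, ← mul_add, ← Finset.sum_add_distrib]
        congr 1
        exact Finset.sum_congr rfl fun k _ => by ring
    _ = (∑ k ∈ Icc 1 X, ((k.divisors.card : ℝ)) ^ 2 * ∑ j ∈ Ico 1 C₀, w j * W0 j k) +
          (∑ j ∈ Ico 1 C₀, w j) * ∑ k ∈ Icc 1 X, ((k.divisors.card : ℝ)) ^ 2 * W1 k := by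
        congr 1
        · rw [Finset.sum_comm]
          refine Finset.sum_congr rfl fun k _ => ?_
          rw [Finset.mul_sum]
          exact Finset.sum_congr rfl fun j _ => by ring
        · rw [Finset.sum_mul]
    _ ≤ (∑ k ∈ Icc 1 X, ((k.divisors.card : ℝ)) ^ 2 *
          ∑ n₁ ∈ SMle k, (n₁.divisors.card : ℝ) * ∑ q ∈ Ico 1 C₀, w q * G k n₁ q) +
          Real.log C₀ * ((Lw ^ (-(1 / Real.log P))) *
            ∑ n ∈ Ioc 0 X, A.a n * ((n.divisors.card : ℝ)) ^ 6) := by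
        refine add_le_add ?_ ?_
        · -- `W₀`: the `j`-sum collapses the `d₁`-sum into `τ(n₁)`
          refine Finset.sum_le_sum fun k _ => mul_le_mul_of_nonneg_left ?_ (by positivity)
          calc ∑ j ∈ Ico 1 C₀, w j * W0 j k
              = ∑ n₁ ∈ SMle k, ∑ j ∈ Ico 1 C₀, w j * ∑ d₁ ∈ n₁.divisors, G k n₁ (j / d₁) := by
                rw [Finset.sum_comm]
                refine Finset.sum_congr rfl fun j _ => ?_
                rw [hW0, Finset.mul_sum]
            _ ≤ ∑ n₁ ∈ SMle k, (n₁.divisors.card : ℝ) * ∑ q ∈ Ico 1 C₀, w q * G k n₁ q := by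
                refine Finset.sum_le_sum fun n₁ _ => ?_
                exact sum_log_sum_divisors_abs_le (A := A) n₁ (RO (k * n₁)) (k * n₁) (z / n₁) s C₀
        · -- `W₁`: Rankin and the sixth moment
          rw [hwsum]
          refine mul_le_mul_of_nonneg_left ?_ (Real.log_nonneg (by exact_mod_cast hC))
          calc ∑ k ∈ Icc 1 X, ((k.divisors.card : ℝ)) ^ 2 * W1 k
              ≤ ∑ k ∈ Icc 1 X, ((k.divisors.card : ℝ)) ^ 2 * ((Lw ^ (-(1 / Real.log P))) *
                  ∑ c ∈ Icc 1 (X / k), ((c.divisors.card : ℝ)) ^ 3 * A.a (k * c)) := by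
                refine Finset.sum_le_sum fun k _ => mul_le_mul_of_nonneg_left ?_ (by positivity)
                exact sum_large_smooth_le_rankin h116 hP hLw k X
            _ = (Lw ^ (-(1 / Real.log P))) * ∑ k ∈ Icc 1 X, ((k.divisors.card : ℝ)) ^ 2 *
                  ∑ c ∈ Icc 1 (X / k), ((c.divisors.card : ℝ)) ^ 3 * A.a (k * c) := by
                rw [Finset.mul_sum]
                exact Finset.sum_congr rfl fun k _ => by ring
            _ ≤ (Lw ^ (-(1 / Real.log P))) * ∑ n ∈ Ioc 0 X, A.a n * ((n.divisors.card : ℝ)) ^ 6 :=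
                mul_le_mul_of_nonneg_left (sum_tau_sq_sum_tau_cube_le X) (Real.rpow_nonneg hLw.le _)

/-! ### The integrated `W₀`: removing `n₁` by the integration over `z` -/

variable {A : SieveSequence} in
/-- **`∫_Y^{eY} W₀(z) dz/z ≪ log C₀ · k₀ K_B (1 + log Δ)`** (FI §10 p. 1065: "change variables
… `w → w n₁` getting `W₀ ≤ ∫∫ ∑_m τ₃(m)|∑*…| dt dw/(tw)`. By the argument that gave (B) ⟹ (B′) …
(10.5)"): for `x ≥ 1`, `s = 2^{k₀}`, `Y > 0`, `Lw ≥ 1`, under (1.16), if every dyadic piece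
`N = 2^i u` with `u ∈ (Y/Lw, eY)` and every integer truncation `1 ≤ q < C₀` satisfies the reduced
sieved bilinear bound `∑_m 6^{ω(m)} |∑_{N<n≤2N, mn≤x, n rough} γ(n;q) μ(mn) a_{mn}| ≤ K_B`, then
`z ↦ W₀(z)/z` is integrable on `[Y, eY]` and `∫_Y^{eY} W₀(z) dz/z ≤ log C₀ · k₀ K_B · (1 + log Lw)`,
where `W₀(z) = ∑_k τ(k)² ∑_{n₁ ≤ Lw} τ(n₁) ∑_q log((q+1)/q) |∑_{n₀ rough}[z/n₁<n₀≤sz/n₁] γ(n₀;q) μ(n₀) a_{kn₁n₀}|`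
(`∫_Y^{eY} |F(z/n₁)| dz/z ≤ ∫_{Y/Lw}^{eY} |F(u)| du/u` for `1 ≤ n₁ ≤ Lw`, the reindexing
`ℓ = kn₁` with weight `6^{ω(ℓ)}`, the dyadic pieces, and `∫_{Y/Lw}^{eY} du/u = 1 + log Lw`).
[cite: FriedlanderIwaniecASP1998, §10 (10.5) p. 1065] -/
theorem integral_W0_le (h116 : ∀ n : ℕ, ¬Squarefree n → A.a n = 0) (P : ℝ) {x : ℝ} (hx : 1 ≤ x)
    (k₀ : ℕ) {Y Lw : ℝ} (hY : 0 < Y) (hLw : 1 ≤ Lw) {C₀ : ℕ} (hC : 1 ≤ C₀) {KB : ℝ}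
    (hB : ∀ u ∈ Set.Ioo (Y / Lw) (Real.exp 1 * Y), ∀ q ∈ Ico 1 C₀, ∀ i ∈ range k₀,
      ∑ m ∈ Icc 1 ⌊x⌋₊, (6 : ℝ) ^ m.primeFactors.card *
        |∑ n ∈ (Ioc ⌊2 ^ i * u⌋₊ ⌊2 * (2 ^ i * u)⌋₊).filter
            (fun n : ℕ => ((m * n : ℕ) : ℝ) ≤ x ∧ ∀ p ∈ n.primeFactors, P ≤ (p : ℝ)),
          (SieveSequence.fiGamma (q : ℝ) n : ℝ) * (μ (m * n) : ℝ) * A.a (m * n)| ≤ KB) :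
    IntervalIntegrable (fun z : ℝ => (∑ k ∈ Icc 1 ⌊x⌋₊, ((k.divisors.card : ℝ)) ^ 2 *
        ∑ n₁ ∈ (Icc 1 (⌊x⌋₊ / k)).filter (fun n : ℕ => Squarefree n ∧
            (∀ p ∈ n.primeFactors, (p : ℝ) < P) ∧ (n : ℝ) ≤ Lw),
          (n₁.divisors.card : ℝ) * ∑ q ∈ Ico 1 C₀, Real.log (((q : ℝ) + 1) / q) *
            |∑ n₀ ∈ (Icc 1 (⌊x⌋₊ / (k * n₁))).filter (fun n : ℕ => ∀ p ∈ n.primeFactors, P ≤ (p : ℝ)),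
              (if z / n₁ < (n₀ : ℝ) ∧ (n₀ : ℝ) ≤ 2 ^ k₀ * (z / n₁) then
                (SieveSequence.fiGamma (q : ℝ) n₀ : ℝ) * (μ n₀ : ℝ) * A.a (k * n₁ * n₀) else 0)|) / z)
      MeasureTheory.volume Y (Real.exp 1 * Y) ∧
    ∫ z in Y..(Real.exp 1 * Y), (∑ k ∈ Icc 1 ⌊x⌋₊, ((k.divisors.card : ℝ)) ^ 2 *
        ∑ n₁ ∈ (Icc 1 (⌊x⌋₊ / k)).filter (fun n : ℕ => Squarefree n ∧
            (∀ p ∈ n.primeFactors, (p : ℝ) < P) ∧ (n : ℝ) ≤ Lw),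
          (n₁.divisors.card : ℝ) * ∑ q ∈ Ico 1 C₀, Real.log (((q : ℝ) + 1) / q) *
            |∑ n₀ ∈ (Icc 1 (⌊x⌋₊ / (k * n₁))).filter (fun n : ℕ => ∀ p ∈ n.primeFactors, P ≤ (p : ℝ)),
              (if z / n₁ < (n₀ : ℝ) ∧ (n₀ : ℝ) ≤ 2 ^ k₀ * (z / n₁) then
                (SieveSequence.fiGamma (q : ℝ) n₀ : ℝ) * (μ n₀ : ℝ) * A.a (k * n₁ * n₀) else 0)|) / z ≤
      Real.log C₀ * (k₀ * KB) * (1 + Real.log Lw) := by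
  classical
  have he1 : (1 : ℝ) ≤ Real.exp 1 := by linarith [Real.add_one_le_exp (1 : ℝ)]
  have hx0 : 0 ≤ x := by linarith
  have hLw0 : 0 < Lw := by linarith
  have hYe : Y ≤ Real.exp 1 * Y := le_mul_of_one_le_left hY.le he1
  have hYL0 : 0 < Y / Lw := div_pos hY hLw0
  have hYLe : Y / Lw ≤ Real.exp 1 * Y := (div_le_self hY.le hLw).trans hYe
  set X := ⌊x⌋₊ with hXdef
  set w : ℕ → ℝ := fun q => Real.log (((q : ℝ) + 1) / q) with hw
  have hw0 : ∀ q ∈ Ico 1 C₀, 0 ≤ w q := fun q hq => log_succ_div_nonneg (Finset.mem_Ico.mp hq).1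
  have hwsum : ∑ q ∈ Ico 1 C₀, w q = Real.log C₀ := by
    have h := sum_Ico_log_succ_div 1 C₀ le_rfl hC
    simp only [Nat.cast_one, Real.log_one, sub_zero] at h
    exact h
  set SMle : ℕ → Finset ℕ := fun k => (Icc 1 (X / k)).filter (fun n : ℕ => Squarefree n ∧
      (∀ p ∈ n.primeFactors, (p : ℝ) < P) ∧ (n : ℝ) ≤ Lw) with hSMle
  set RO : ℕ → Finset ℕ := fun ℓ =>
    (Icc 1 (X / ℓ)).filter (fun n : ℕ => ∀ p ∈ n.primeFactors, P ≤ (p : ℝ)) with hRO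
  -- the rough inner sums as functions of `u`
  set Gs : ℕ → ℕ → ℝ → ℝ := fun ℓ q u => ∑ n₀ ∈ RO ℓ,
      (if u < (n₀ : ℝ) ∧ (n₀ : ℝ) ≤ 2 ^ k₀ * u then
        (SieveSequence.fiGamma (q : ℝ) n₀ : ℝ) * (μ n₀ : ℝ) * A.a (ℓ * n₀) else 0) with hGs
  have hGm : ∀ ℓ q, Measurable (Gs ℓ q) := fun ℓ q =>
    measurable_window_sum (RO ℓ) (fun n₀ => (SieveSequence.fiGamma (q : ℝ) n₀ : ℝ) * (μ n₀ : ℝ) * A.a (ℓ * n₀))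
      (2 ^ k₀)
  have hGam : ∀ ℓ q, Measurable fun u => |Gs ℓ q u| := fun ℓ q =>
    continuous_abs.measurable.comp (hGm ℓ q)
  set Mb : ℕ → ℕ → ℝ := fun ℓ q => ∑ n₀ ∈ RO ℓ,
      |(SieveSequence.fiGamma (q : ℝ) n₀ : ℝ) * (μ n₀ : ℝ) * A.a (ℓ * n₀)| with hMb
  have hGb : ∀ ℓ q u, |Gs ℓ q u| ≤ Mb ℓ q := fun ℓ q u =>
    abs_window_sum_le (RO ℓ) (fun n₀ => (SieveSequence.fiGamma (q : ℝ) n₀ : ℝ) * (μ n₀ : ℝ) * A.a (ℓ * n₀))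
      (2 ^ k₀) u
  have hGab : ∀ ℓ q u, |(fun u => |Gs ℓ q u|) u| ≤ Mb ℓ q := fun ℓ q u => by
    simpa only [abs_abs] using hGb ℓ q u
  -- `Gs ℓ q ≡ 0` unless `ℓ` is squarefree
  have hGsq : ∀ ℓ, ¬Squarefree ℓ → ∀ q u, Gs ℓ q u = 0 := by
    intro ℓ hℓ q u
    refine Finset.sum_eq_zero fun n₀ _ => ?_
    have : ¬Squarefree (ℓ * n₀) := fun h => hℓ (Squarefree.of_mul_left h)
    rw [h116 _ this, mul_zero, ite_self]
  -- integrability of the pieces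
  have hpiece : ∀ (ℓ q : ℕ) (ν : ℝ) {a b : ℝ}, 0 < a → a ≤ b →
      IntervalIntegrable (fun y => |Gs ℓ q (y / ν)| / y) MeasureTheory.volume a b :=
    fun ℓ q ν a b ha hab =>
      intervalIntegrable_comp_div_div (h := fun u => |Gs ℓ q u|) (hGam ℓ q) (hGab ℓ q) ν ha hab
  have hpiece1 : ∀ (ℓ q : ℕ) {a b : ℝ}, 0 < a → a ≤ b →
      IntervalIntegrable (fun u => |Gs ℓ q u| / u) MeasureTheory.volume a b := fun ℓ q a b ha hab => by
    simpa only [div_one] using hpiece ℓ q 1 ha hab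
  -- the integrand as an explicit triple sum of pieces
  set coef : ℕ → ℕ → ℕ → ℝ := fun k n₁ q =>
    ((k.divisors.card : ℝ)) ^ 2 * ((n₁.divisors.card : ℝ) * w q) with hcoef
  have hcoef0 : ∀ k n₁, ∀ q ∈ Ico 1 C₀, 0 ≤ coef k n₁ q := fun k n₁ q hq => by
    rw [hcoef]; exact mul_nonneg (by positivity) (mul_nonneg (Nat.cast_nonneg _) (hw0 q hq))
  have hW0eq : ∀ z, (∑ k ∈ Icc 1 X, ((k.divisors.card : ℝ)) ^ 2 *
        ∑ n₁ ∈ SMle k, (n₁.divisors.card : ℝ) * ∑ q ∈ Ico 1 C₀, w q * |Gs (k * n₁) q (z / n₁)|) / z =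
      ∑ k ∈ Icc 1 X, ∑ n₁ ∈ SMle k, ∑ q ∈ Ico 1 C₀, coef k n₁ q * (|Gs (k * n₁) q (z / n₁)| / z) := by
    intro z
    rw [Finset.sum_div]
    refine Finset.sum_congr rfl fun k _ => ?_
    rw [Finset.mul_sum, Finset.sum_div]
    refine Finset.sum_congr rfl fun n₁ _ => ?_
    rw [Finset.mul_sum, Finset.mul_sum, Finset.sum_div]
    refine Finset.sum_congr rfl fun q _ => ?_
    rw [hcoef]
    ring
  have hint : IntervalIntegrable (fun z => ∑ k ∈ Icc 1 X, ∑ n₁ ∈ SMle k, ∑ q ∈ Ico 1 C₀,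
      coef k n₁ q * (|Gs (k * n₁) q (z / n₁)| / z)) MeasureTheory.volume Y (Real.exp 1 * Y) := by
    refine intervalIntegrable_finset_sum_fun _ fun k _ => ?_
    refine intervalIntegrable_finset_sum_fun _ fun n₁ _ => ?_
    refine intervalIntegrable_finset_sum_fun _ fun q _ => ?_
    exact (hpiece (k * n₁) q n₁ hY hYe).const_mul _
  have hfun : (fun z : ℝ => (∑ k ∈ Icc 1 X, ((k.divisors.card : ℝ)) ^ 2 *
        ∑ n₁ ∈ SMle k, (n₁.divisors.card : ℝ) * ∑ q ∈ Ico 1 C₀, w q * |Gs (k * n₁) q (z / n₁)|) / z) =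
      fun z => ∑ k ∈ Icc 1 X, ∑ n₁ ∈ SMle k, ∑ q ∈ Ico 1 C₀,
        coef k n₁ q * (|Gs (k * n₁) q (z / n₁)| / z) := funext hW0eq
  refine ⟨by rw [hfun]; exact hint, ?_⟩
  rw [hfun]
  -- Step (B): push the integral through the sums
  have hBeq : ∫ z in Y..(Real.exp 1 * Y), ∑ k ∈ Icc 1 X, ∑ n₁ ∈ SMle k, ∑ q ∈ Ico 1 C₀,
        coef k n₁ q * (|Gs (k * n₁) q (z / n₁)| / z) =
      ∑ k ∈ Icc 1 X, ∑ n₁ ∈ SMle k, ∑ q ∈ Ico 1 C₀,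
        coef k n₁ q * ∫ z in Y..(Real.exp 1 * Y), |Gs (k * n₁) q (z / n₁)| / z := by
    rw [intervalIntegral.integral_finsetSum (fun k _ =>
      intervalIntegrable_finset_sum_fun _ fun n₁ _ =>
        intervalIntegrable_finset_sum_fun _ fun q _ => (hpiece (k * n₁) q n₁ hY hYe).const_mul _)]
    refine Finset.sum_congr rfl fun k _ => ?_
    rw [intervalIntegral.integral_finsetSum (fun n₁ _ =>
      intervalIntegrable_finset_sum_fun _ fun q _ => (hpiece (k * n₁) q n₁ hY hYe).const_mul _)]
    refine Finset.sum_congr rfl fun n₁ _ => ?_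
    rw [intervalIntegral.integral_finsetSum (fun q _ => (hpiece (k * n₁) q n₁ hY hYe).const_mul _)]
    refine Finset.sum_congr rfl fun q _ => ?_
    exact intervalIntegral.integral_const_mul _ _
  -- Step (C): the change of variables `u = z/n₁`, `1 ≤ n₁ ≤ Lw`
  set I : ℕ → ℕ → ℝ := fun ℓ q => ∫ u in (Y / Lw)..(Real.exp 1 * Y), |Gs ℓ q u| / u with hI
  have hI0 : ∀ ℓ q, 0 ≤ I ℓ q := fun ℓ q =>
    intervalIntegral.integral_nonneg hYLe fun u hu => div_nonneg (abs_nonneg _) (hYL0.le.trans hu.1)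
  have hIsq : ∀ q ℓ, ¬Squarefree ℓ → I ℓ q = 0 := by
    intro q ℓ hℓ
    rw [hI]
    dsimp only
    simp_rw [hGsq ℓ hℓ q, abs_zero, zero_div]
    exact intervalIntegral.integral_zero
  have hCle : (∑ k ∈ Icc 1 X, ∑ n₁ ∈ SMle k, ∑ q ∈ Ico 1 C₀,
        coef k n₁ q * ∫ z in Y..(Real.exp 1 * Y), |Gs (k * n₁) q (z / n₁)| / z) ≤
      ∑ k ∈ Icc 1 X, ∑ n₁ ∈ SMle k, ∑ q ∈ Ico 1 C₀, coef k n₁ q * I (k * n₁) q := by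
    refine Finset.sum_le_sum fun k _ => Finset.sum_le_sum fun n₁ hn₁ => Finset.sum_le_sum fun q hq => ?_
    refine mul_le_mul_of_nonneg_left ?_ (hcoef0 k n₁ q hq)
    obtain ⟨hI1, -, -, hνL⟩ := Finset.mem_filter.mp hn₁
    exact intervalIntegral_comp_div_le (h := fun u => |Gs (k * n₁) q u|) (hGam _ _)
      (fun u => abs_nonneg _) (fun u => hGb _ _ u) hY (by exact_mod_cast (Finset.mem_Icc.mp hI1).1) hνL
  -- Step (D): reorder and reindex `ℓ = k n₁` with the weight `6^{ω(ℓ)}`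
  have hDle : (∑ k ∈ Icc 1 X, ∑ n₁ ∈ SMle k, ∑ q ∈ Ico 1 C₀, coef k n₁ q * I (k * n₁) q) ≤
      ∑ q ∈ Ico 1 C₀, w q * ∑ ℓ ∈ Icc 1 X, (6 : ℝ) ^ ℓ.primeFactors.card * I ℓ q := by
    have heq : (∑ k ∈ Icc 1 X, ∑ n₁ ∈ SMle k, ∑ q ∈ Ico 1 C₀, coef k n₁ q * I (k * n₁) q) =
        ∑ q ∈ Ico 1 C₀, w q * ∑ k ∈ Icc 1 X, ((k.divisors.card : ℝ)) ^ 2 *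
          ∑ n₁ ∈ SMle k, (n₁.divisors.card : ℝ) * I (k * n₁) q := by
      rw [Finset.sum_congr rfl (fun k _ => Finset.sum_comm), Finset.sum_comm]
      refine Finset.sum_congr rfl fun q _ => ?_
      rw [Finset.mul_sum]
      refine Finset.sum_congr rfl fun k _ => ?_
      rw [Finset.mul_sum, Finset.mul_sum]
      refine Finset.sum_congr rfl fun n₁ _ => ?_
      rw [hcoef]; ring
    rw [heq]
    refine Finset.sum_le_sum fun q hq => mul_le_mul_of_nonneg_left ?_ (hw0 q hq)
    exact sum_tau_sq_sum_tau_mul_le (J := fun ℓ => I ℓ q) (fun ℓ => hI0 ℓ q) (fun ℓ hℓ => hIsq q ℓ hℓ) X _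
  -- Step (E): for each `q`, `∑_ℓ 6^ω I(ℓ, q) ≤ k₀ K_B (1 + log Lw)`
  have hEle : ∀ q ∈ Ico 1 C₀, ∑ ℓ ∈ Icc 1 X, (6 : ℝ) ^ ℓ.primeFactors.card * I ℓ q ≤
      (k₀ * KB) * (1 + Real.log Lw) := by
    intro q hq
    -- pull the sum inside the integral
    have h1 : ∑ ℓ ∈ Icc 1 X, (6 : ℝ) ^ ℓ.primeFactors.card * I ℓ q =
        ∫ u in (Y / Lw)..(Real.exp 1 * Y), ∑ ℓ ∈ Icc 1 X,
          (6 : ℝ) ^ ℓ.primeFactors.card * (|Gs ℓ q u| / u) := by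
      rw [intervalIntegral.integral_finsetSum (fun ℓ _ => (hpiece1 ℓ q hYL0 hYLe).const_mul _)]
      refine Finset.sum_congr rfl fun ℓ _ => ?_
      rw [hI]
      exact (intervalIntegral.integral_const_mul _ _).symm
    rw [h1]
    -- pointwise bound on `(Y/Lw, eY)`
    have hpt : ∀ u ∈ Set.Ioo (Y / Lw) (Real.exp 1 * Y),
        (∑ ℓ ∈ Icc 1 X, (6 : ℝ) ^ ℓ.primeFactors.card * (|Gs ℓ q u| / u)) ≤ (k₀ * KB) * u⁻¹ := by
      intro u hu
      have hu0 : 0 < u := hYL0.trans hu.1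
      have hsum : ∑ ℓ ∈ Icc 1 X, (6 : ℝ) ^ ℓ.primeFactors.card * |Gs ℓ q u| ≤ k₀ * KB :=
        sum_six_pow_abs_rough_inner_le h116 P hx0 hu0.le k₀ (q : ℝ) (hB u hu q hq)
      have heq : (∑ ℓ ∈ Icc 1 X, (6 : ℝ) ^ ℓ.primeFactors.card * (|Gs ℓ q u| / u)) =
          u⁻¹ * ∑ ℓ ∈ Icc 1 X, (6 : ℝ) ^ ℓ.primeFactors.card * |Gs ℓ q u| := by
        rw [Finset.mul_sum]
        exact Finset.sum_congr rfl fun ℓ _ => by rw [div_eq_mul_inv]; ring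
      rw [heq]
      calc u⁻¹ * ∑ ℓ ∈ Icc 1 X, (6 : ℝ) ^ ℓ.primeFactors.card * |Gs ℓ q u| ≤ u⁻¹ * (k₀ * KB) :=
            mul_le_mul_of_nonneg_left hsum (inv_nonneg.mpr hu0.le)
        _ = (k₀ * KB) * u⁻¹ := mul_comm _ _
    have hinv : IntervalIntegrable (fun u : ℝ => (k₀ * KB) * u⁻¹) MeasureTheory.volume (Y / Lw)
        (Real.exp 1 * Y) := by
      refine (intervalIntegral.intervalIntegrable_inv (fun u hu => ?_) continuousOn_id).const_mul _
      rw [Set.uIcc_of_le hYLe] at hu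
      exact (hYL0.trans_le hu.1).ne'
    have hle : (∫ u in (Y / Lw)..(Real.exp 1 * Y), ∑ ℓ ∈ Icc 1 X,
          (6 : ℝ) ^ ℓ.primeFactors.card * (|Gs ℓ q u| / u)) ≤
        ∫ u in (Y / Lw)..(Real.exp 1 * Y), (k₀ * KB) * u⁻¹ := by
      refine intervalIntegral.integral_mono_on_of_le_Ioo hYLe ?_ hinv hpt
      exact intervalIntegrable_finset_sum_fun _ fun ℓ _ => (hpiece1 ℓ q hYL0 hYLe).const_mul _
    have hval : (∫ u in (Y / Lw)..(Real.exp 1 * Y), (k₀ * KB) * u⁻¹) = (k₀ * KB) * (1 + Real.log Lw) := by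
      rw [intervalIntegral.integral_const_mul,
        integral_inv (Set.notMem_uIcc_of_lt hYL0 (by positivity))]
      congr 1
      have : Real.exp 1 * Y / (Y / Lw) = Real.exp 1 * Lw := by
        rw [div_div_eq_mul_div, mul_assoc, mul_comm Y Lw, ← mul_assoc, mul_div_assoc, div_self hY.ne',
          mul_one]
      rw [this, Real.log_mul (Real.exp_pos 1).ne' hLw0.ne', Real.log_exp]
    exact hle.trans (le_of_eq hval)
  -- Step (F): combine
  calc ∫ z in Y..(Real.exp 1 * Y), ∑ k ∈ Icc 1 X, ∑ n₁ ∈ SMle k, ∑ q ∈ Ico 1 C₀,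
          coef k n₁ q * (|Gs (k * n₁) q (z / n₁)| / z)
      = ∑ k ∈ Icc 1 X, ∑ n₁ ∈ SMle k, ∑ q ∈ Ico 1 C₀,
          coef k n₁ q * ∫ z in Y..(Real.exp 1 * Y), |Gs (k * n₁) q (z / n₁)| / z := hBeq
    _ ≤ ∑ k ∈ Icc 1 X, ∑ n₁ ∈ SMle k, ∑ q ∈ Ico 1 C₀, coef k n₁ q * I (k * n₁) q := hCle
    _ ≤ ∑ q ∈ Ico 1 C₀, w q * ∑ ℓ ∈ Icc 1 X, (6 : ℝ) ^ ℓ.primeFactors.card * I ℓ q := hDle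
    _ ≤ ∑ q ∈ Ico 1 C₀, w q * ((k₀ * KB) * (1 + Real.log Lw)) :=
        Finset.sum_le_sum fun q hq => mul_le_mul_of_nonneg_left (hEle q hq) (hw0 q hq)
    _ = Real.log C₀ * (k₀ * KB) * (1 + Real.log Lw) := by rw [← Finset.sum_mul, hwsum]; ring

/-! ### Assembly: (8.5) under (B*) -/

set_option maxHeartbeats 400000 in -- the pointwise assembly carries the ~40 local facts of `…S3Assembly` plus the `W₀/W₁` data; 2× the default budget
/-- **FI (8.5) under (B*) with an implied constant**: `S₃(x; y, Z) ≪ A(x)(log x)⁻¹` in the rough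
regime with the clauses unbundled — the core clauses `FIAsymptoticSieveHypothesesCore A D`, the
parameter clause (10.2) for `δ = (log x)^α`, `Δ_B = x^{2θ}`, `P`, upper-bound sieve weights of sifting
range `x^{θ₁}` and level `x^{θ/2}` (`0 < θ₁ ≤ θ/2`, `θ < 1/6`), and (B*) with a CONSTANT `K_B*`,
`∑_m |∑*…| ≤ K_B* A(x)(log x)^{-2^{26}}` (the print, p. 1063, has "`≪`"; the bundled
`FIRegimeRough` is the case `K_B* = 1`, `fi_asp_S3_estimate_rough_holds` below). FI §10: "(B) was
used solely to estimate the sums `S₂` and `S₃` … In the case of `S₃` we note that (8.1) may be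
integrated over `z` in place of `w` and there `λ⁻(c)` is the integral of `γ(c, t)` as required …
(B*) implies (B̃)". The proof is the tree's `fi_asp_S3_estimate_of_cancellation` (`…S3Assembly`)
for `S*` and `S'` (their bounds `abs_S3star_le`, `abs_S3prime_le`, `integral_boundary_terms_le` use
(2.4), now the theorem `fi_moebius_density_cancellation_holds`, and (R′), never (B)), with the new
treatment of `S⁻`: pointwise in `z`, `|S⁻| ≤ ∑_j log((j+1)/j) ∑_k τ(k)² |T_j(k,z)|`
(`abs_S3minus_le_weighted_sum`) `≤ W₀(z) + W₁` (`weighted_T_sum_le`: the decomposition `c = n₁n₀`,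
the `j`-regrouping, Rankin's trick `W₁ ≤ log C₀ · x^{-(θ/2)/log P} ∑ a_n τ(n)⁶ ≤ 2C₆A(x)(log x)^{-6}`
by (10.2), `rankin_rpow_le_log_rpow`, and the sixth moment), and after the integration over
`z ∈ [Y, eY]`, `∫ W₀ dz/z ≤ log C₀ · k₀ K_B A(x)(log x)^{-5} (1 + log Δ) ≤ 16 K_B A(x)(log x)^{-2}`
(`integral_W0_le` with the reduced sieved bilinear bound
`FIAsymptoticSieveHypothesesCore.reduced_rough_bilinear_bound_six_of_bilinear` (`…RoughK`, the
constant `K_B*` cleared by one power of `log x`) on the pieces `N = 2^i u`, `u ∈ (Y/Δ, eY)`, which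
lie in the range of (B*) for `Δ_B = x^{2θ}` since `Y/Δ = x^{-θ}√D ≥ x^{-2θ}√D`).
[cite: FriedlanderIwaniecASP1998, §8 (8.5) and §10 pp. 1063-1065] -/
theorem fi_asp_S3_estimate_roughK (A : SieveSequence) (D : ℝ → ℝ) (α θ θ₁ : ℝ)
    (lam : ℝ → ℕ → ℤ) (P : ℝ → ℝ) {KBst : ℝ} (hα : 0 < α) (hθ₁ : 0 < θ₁) (hθ₁le : θ₁ ≤ θ / 2)
    (hθ6 : θ < 1 / 6) (hcore : A.FIAsymptoticSieveHypothesesCore D)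
    (hparams : ∀ᶠ x : ℝ in atTop, 2 ≤ Real.log x ^ α ∧ 2 ≤ x ^ (2 * θ) ∧ 2 ≤ P x ∧
      P x ≤ (x ^ (2 * θ)) ^ (1 / (2 ^ 35 * Real.log (Real.log x))))
    (hB : ∀ᶠ x : ℝ in atTop, ∀ N : ℝ, Real.sqrt (D x) / x ^ (2 * θ) < N →
      N < Real.sqrt x / Real.log x ^ α → ∀ C : ℝ, 1 ≤ C → C ≤ x / D x →
        A.fiBilinearRough x N C (P x) ≤ KBst * A.size x / Real.log x ^ (2 ^ 26 : ℕ))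
    (hweights : ∀ᶠ x : ℝ in atTop, IsUpperSieveWeights (x ^ θ₁) (x ^ (θ / 2)) (lam x)) :
    ∃ K : ℝ, ∀ᶠ x : ℝ in atTop, ∀ s : ℝ, IsFISplit D α θ x s →
      ∀ y : ℝ, fiY D θ x ≤ y → y ≤ Real.exp 1 * fiY D θ x →
        |A.fiS3Z (lam x) s x y (fiY D θ x)| ≤ K * A.size x / Real.log x := by
  classical
  have hhyp := hcore.withTrivialBilinear
  have hsize : ∀ t, A.size t = A.congrSum 1 t := hhyp.1
  have h116 : ∀ n : ℕ, ¬Squarefree n → A.a n = 0 := hhyp.2.2.2.2.2.1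
  obtain ⟨K, hK⟩ := hhyp.2.2.2.1
  obtain ⟨c₉, K₉, h19⟩ := hhyp.2.2.2.2.1
  obtain ⟨K₂₄, h24'⟩ := fi_moebius_density_cancellation_holds A.density A.density_mult ⟨K, hK⟩
    ⟨c₉, K₉, h19⟩
  obtain ⟨K_R, hR'⟩ := fi_reduced_remainder_bound_holds A D _ _ hhyp
  obtain ⟨KB, hKB⟩ := hcore.reduced_rough_bilinear_bound_six_of_bilinear
    (δ := fun x => Real.log x ^ α) (Δ := fun x => x ^ (2 * θ)) (P := P) hB (k := 5) (by norm_num)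
  obtain ⟨K₆, h16c⟩ := hcore.2.2.1
  have hg : A.density.IsMultiplicative := A.density_mult
  have hg0 : ∀ p : ℕ, p.Prime → 0 ≤ A.density p := fun p hp => (hK p hp).1
  have hθ : 0 < θ := by linarith
  have hθ3 : θ < 1 / 3 := by linarith
  -- constants
  set K' := max K 0 with hK'
  set L2 := |K₉| / Real.log 2 ^ 10 with hL2
  set E₂ := Real.exp (2 * (|c₉| + L2) + 6 * K') with hE₂
  set E₁ := Real.exp (|c₉| + L2 + 3 * K') with hE₁
  set Kstar := E₂ * E₁ ^ 2 * (2 * |K₂₄|) * 4 ^ 6 with hKstar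
  set KB' := max KB 0 with hKB'
  set KR' := max K_R 0 with hKR'
  have hKB'0 : 0 ≤ KB' := le_max_right _ _
  have hKR'0 : 0 ≤ KR' := le_max_right _ _
  have hKstar0 : 0 ≤ Kstar := by positivity
  set C6 : ℝ := 2 ^ 18 * max K₆ 0 * Real.exp (2 ^ 28) with hC6
  have hC60 : 0 ≤ C6 := by positivity
  refine ⟨Kstar + 16 * KB' + 6 * KR' + 2 * C6, ?_⟩
  have hR1 : ∀ᶠ x : ℝ in atTop, x ^ (2 / 3 : ℝ) < D x ∧ D x < x :=
    hhyp.2.2.2.2.2.2.1.mono fun x hx => ⟨hx.1, hx.2.1⟩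
  have hllev : ∀ᶠ x : ℝ in atTop, 0 < Real.log (Real.log x) :=
    ((Real.tendsto_log_atTop.comp Real.tendsto_log_atTop).eventually_gt_atTop 0).mono fun x hx => hx
  filter_upwards [hweights, hKB, hR', hR1, eventually_exp_mul_fiY_le_sqrt hθ hR1,
    eventually_ge_atTop (16 : ℝ), eventually_ge_atTop (Real.exp 1),
    eventually_log_rpow_le_mul_rpow α (s := 1 / 4 - θ / 2) (c := 1 / 16) (by linarith) (by norm_num),
    (tendsto_rpow_atTop hθ₁).eventually_ge_atTop (2 : ℝ), h16c, hparams, hllev]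
    with x hw hBx hRx hR1x heY hx16 hxe h16 hP2 h16x hparx hll
  intro s hs y hYy hyY
  -- basic facts at `x`
  have he1 : (1 : ℝ) ≤ Real.exp 1 := by linarith [Real.add_one_le_exp (1 : ℝ)]
  have hx1 : 1 ≤ x := by linarith only [he1, hxe]
  have hx1' : 1 < x := by linarith only [hx16]
  have hx0 : 0 < x := by linarith only [hx1]
  have hlogx : 1 ≤ Real.log x := by rw [Real.le_log_iff_exp_le hx0]; exact hxe
  have hlogx0 : 0 < Real.log x := by linarith only [hlogx]
  have hD0 : 0 < D x := lt_trans (by positivity) hR1x.1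
  have hDx : D x < x := hR1x.2
  have hD1 : 1 ≤ D x := le_trans (Real.one_le_rpow hx1 (by norm_num)) hR1x.1.le
  have hA0 : 0 ≤ A.size x := by rw [hsize]; exact A.congrSum_nonneg 1 x
  obtain ⟨δ, hδ⟩ : ∃ δ : ℝ, δ = Real.log x ^ α := ⟨_, rfl⟩
  have hδ1 : 1 ≤ δ := by rw [hδ]; exact Real.one_le_rpow hlogx hα.le
  have hδ0 : 0 < δ := by linarith only [hδ1]
  have hlα0 : 0 < Real.log x ^ α := Real.rpow_pos_of_pos hlogx0 α
  obtain ⟨Lw, hLw⟩ : ∃ Lw : ℝ, Lw = x ^ (θ / 2) := ⟨_, rfl⟩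
  rw [← hLw] at hw
  set Pw := x ^ θ₁ with hPw
  have hxθ0 : 0 < x ^ (θ / 2) := Real.rpow_pos_of_pos hx0 _
  have hLw0 : 0 < Lw := by rw [hLw]; exact hxθ0
  have hLw1 : 1 ≤ Lw := by rw [hLw]; exact Real.one_le_rpow hx1 (by linarith only [hθ])
  have hP0 : 0 < Pw := Real.rpow_pos_of_pos hx0 _
  have hsqrt0 : 0 < Real.sqrt x := Real.sqrt_pos.mpr hx0
  set X := ⌊x⌋₊ with hXdef
  have hX2 : 2 ≤ X := Nat.le_floor (by push_cast; linarith only [hx16])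
  have hlogX : Real.log X ≤ Real.log x :=
    Real.log_le_log (by exact_mod_cast (show 0 < X by omega)) (Nat.floor_le hx0.le)
  have hlogX0 : 0 ≤ Real.log X := Real.log_nonneg (by exact_mod_cast (show 1 ≤ X by omega))
  -- `Y`, `u₀`, `s`
  set Y := fiY D θ x with hYdef
  obtain ⟨hY0, hYP⟩ := fiY_pos_and_ge (D := D) (θ := θ) (θ₁ := θ₁) hx1 hR1x.1 (by linarith only [hθ₁le, hθ3])
  obtain ⟨u₀, hu₀⟩ : ∃ u₀ : ℝ, u₀ = Real.sqrt x / (8 * δ) := ⟨_, rfl⟩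
  have hu₀0 : 0 < u₀ := by rw [hu₀]; exact div_pos hsqrt0 (mul_pos (by norm_num) hδ0)
  have hSY : fiSLow D α θ x * Y = u₀ := by
    rw [hu₀, hδ]
    show fiSLow D α θ x * fiY D θ x = Real.sqrt x / (8 * Real.log x ^ α)
    have hb : 8 * Real.log x ^ α * Real.sqrt (D x) * x ^ (θ / 2) ≠ 0 :=
      mul_ne_zero (mul_ne_zero (mul_ne_zero (by norm_num) hlα0.ne') (Real.sqrt_pos.mpr hD0).ne')
        hxθ0.ne'
    have hd : (8 * Real.log x ^ α) ≠ 0 := mul_ne_zero (by norm_num) hlα0.ne'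
    rw [fiSLow, fiY, div_mul_div_comm, div_eq_div_iff hb hd]
    ring
  have hfS0 : 0 < fiSLow D α θ x := by
    unfold fiSLow
    exact div_pos (mul_pos hxθ0 hsqrt0) (mul_pos (mul_pos (by norm_num) hlα0) (Real.sqrt_pos.mpr hD0))
  obtain ⟨⟨k₀, rfl⟩, hslow, hsup⟩ := hs
  have hs0 : (0 : ℝ) < 2 ^ k₀ := by positivity
  have hsy_gt : u₀ < 2 ^ k₀ * y := by
    calc u₀ = fiSLow D α θ x * Y := hSY.symm
      _ < 2 ^ k₀ * Y := mul_lt_mul_of_pos_right hslow hY0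
      _ ≤ 2 ^ k₀ * y := mul_le_mul_of_nonneg_left hYy hs0.le
  have hsy0 : 0 ≤ 2 ^ k₀ * y := by linarith only [hu₀0, hsy_gt]
  have hfiSLow_le : fiSLow D α θ x ≤ x ^ 2 / 8 := by
    unfold fiSLow
    rw [div_le_div_iff₀ (by positivity) (by norm_num : (0 : ℝ) < 8)]
    have hLwx : x ^ (θ / 2) ≤ x := by
      calc x ^ (θ / 2) ≤ x ^ (1 : ℝ) := Real.rpow_le_rpow_of_exponent_le hx1 (by linarith only [hθ, hθ3])
        _ = x := Real.rpow_one x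
    have h2 : Real.sqrt x ≤ x := Real.sqrt_le_self_iff.mpr (Or.inr hx1)
    have h4 : 1 ≤ Real.sqrt (D x) := Real.one_le_sqrt.mpr hD1
    have hlα1 : 1 ≤ Real.log x ^ α := Real.one_le_rpow hlogx hα.le
    have h5 : x ^ (θ / 2) * Real.sqrt x ≤ x * x := mul_le_mul hLwx h2 hsqrt0.le hx0.le
    calc x ^ (θ / 2) * Real.sqrt x * 8 ≤ x * x * (8 * 1 * 1) := by linarith only [h5]
      _ ≤ x * x * (8 * Real.log x ^ α * Real.sqrt (D x)) := by
          refine mul_le_mul_of_nonneg_left ?_ (mul_nonneg hx0.le hx0.le)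
          exact mul_le_mul (mul_le_mul_of_nonneg_left hlα1 (by norm_num)) h4 zero_le_one
            (mul_nonneg (by norm_num) hlα0.le)
      _ = x ^ 2 * (8 * Real.log x ^ α * Real.sqrt (D x)) := by rw [sq]
  have hk₀ : (k₀ : ℝ) ≤ 4 * Real.log x := by
    refine nat_le_four_mul_log_of_two_pow_le ?_
    have hx2 : 0 ≤ x ^ 2 := sq_nonneg x
    linarith only [hsup, hfiSLow_le, hx2]
  -- `C₀ = ⌈x/D⌉`, `Dn = ⌊D⌋`
  set C₀ := ⌈x / D x⌉₊ with hC₀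
  have hxD0 : 0 < x / D x := div_pos hx0 hD0
  have hC1 : 1 ≤ C₀ := Nat.one_le_iff_ne_zero.mpr (Nat.pos_iff_ne_zero.mp (Nat.ceil_pos.mpr hxD0))
  have hC₀le : (C₀ : ℝ) < x / D x + 1 := Nat.ceil_lt_add_one hxD0.le
  have hC₀ge : x / D x ≤ C₀ := Nat.le_ceil _
  have hlogC₀ : Real.log C₀ ≤ 2 * Real.log x := by
    have h1 : (C₀ : ℝ) ≤ 2 * x := by
      have : x / D x ≤ x := div_le_self hx0.le hD1
      linarith only [this, hC₀le, hx1]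
    have h2 : Real.log C₀ ≤ Real.log (2 * x) := Real.log_le_log (by exact_mod_cast hC1) h1
    rw [Real.log_mul (by norm_num) hx0.ne'] at h2
    have h3 : Real.log 2 ≤ Real.log x := Real.log_le_log (by norm_num) (by linarith only [hx16])
    linarith only [h2, h3]
  set Dn := ⌊D x⌋₊ with hDn
  have hDn1 : 1 ≤ Dn := Nat.le_floor (by exact_mod_cast hD1)
  have hDfl : (Dn : ℝ) ≤ D x := Nat.floor_le hD0.le
  have hlogDn : Real.log Dn ≤ Real.log x :=
    Real.log_le_log (by exact_mod_cast hDn1) (hDfl.trans hDx.le)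
  have hDcond : ∀ d : ℕ, ((d * C₀ : ℕ) : ℝ) < x → d ≤ Dn := by
    intro d hd
    refine Nat.le_floor ?_
    have hC₀0 : (0 : ℝ) < C₀ := by exact_mod_cast hC1
    push_cast at hd
    have h1 : (d : ℝ) < x / C₀ := by rw [lt_div_iff₀ hC₀0]; exact hd
    have h2 : x / C₀ ≤ D x := by
      rw [div_le_iff₀ hC₀0]
      calc x = x / D x * D x := by field_simp
        _ ≤ C₀ * D x := mul_le_mul_of_nonneg_right hC₀ge hD0.le
        _ = D x * C₀ := mul_comm _ _
    linarith only [h1, h2]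
  -- `a₀ = ⌊sy/Lw⌋ ≥ x^{1/4}`
  obtain ⟨a₀, ha₀⟩ : ∃ a₀ : ℕ, a₀ = ⌊2 ^ k₀ * y / Lw⌋₊ := ⟨_, rfl⟩
  have hx14 : (2 : ℝ) ≤ x ^ (1 / 4 : ℝ) := by
    have h44 : ((4 : ℕ) : ℝ)⁻¹ = (1 / 4 : ℝ) := by norm_num
    have h2 : ((2 : ℝ) ^ (4 : ℕ)) ^ (1 / 4 : ℝ) = 2 := by
      rw [← h44]; exact Real.pow_rpow_inv_natCast zero_le_two four_ne_zero
    have h16x : (2 : ℝ) ^ (4 : ℕ) ≤ x := le_trans (by norm_num) hx16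
    have h3 : ((2 : ℝ) ^ (4 : ℕ)) ^ (1 / 4 : ℝ) ≤ x ^ (1 / 4 : ℝ) :=
      Real.rpow_le_rpow (pow_nonneg zero_le_two 4) h16x (by norm_num)
    rw [h2] at h3
    exact h3
  have ha₀ge : x ^ (1 / 4 : ℝ) ≤ a₀ := by
    -- `sy/Lw > u₀/Lw = x^{1/2-θ/2}/(8δ) ≥ 2 x^{1/4} ≥ x^{1/4} + 1`
    have h1 : u₀ / Lw ≤ 2 ^ k₀ * y / Lw := div_le_div_of_nonneg_right hsy_gt.le hLw0.le
    have h2 : x ^ (1 / 4 : ℝ) + 1 ≤ u₀ / Lw := by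
      rw [hu₀, hLw, div_div, le_div_iff₀ (mul_pos (mul_pos (by norm_num) hδ0) hxθ0)]
      have hx14' : (1 : ℝ) ≤ x ^ (1 / 4 : ℝ) := by linarith only [hx14]
      have hsplit : Real.sqrt x = x ^ (1 / 4 : ℝ) * (x ^ (1 / 4 - θ / 2 : ℝ) * x ^ (θ / 2)) := by
        rw [← Real.rpow_add hx0, ← Real.rpow_add hx0, Real.sqrt_eq_rpow]; norm_num
      rw [hsplit]
      have h3 : (x ^ (1 / 4 : ℝ) + 1) * (8 * δ * x ^ (θ / 2)) ≤ (2 * x ^ (1 / 4 : ℝ)) * (8 * δ * x ^ (θ / 2)) :=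
        mul_le_mul_of_nonneg_right (by linarith only [hx14']) (mul_pos (mul_pos (by norm_num) hδ0) hxθ0).le
      refine h3.trans ?_
      have h4 : 16 * δ ≤ x ^ (1 / 4 - θ / 2 : ℝ) := by rw [hδ]; linarith only [h16]
      calc 2 * x ^ (1 / 4 : ℝ) * (8 * δ * x ^ (θ / 2)) = x ^ (1 / 4 : ℝ) * ((16 * δ) * x ^ (θ / 2)) := by ring
        _ ≤ x ^ (1 / 4 : ℝ) * (x ^ (1 / 4 - θ / 2 : ℝ) * x ^ (θ / 2)) :=
            mul_le_mul_of_nonneg_left (mul_le_mul_of_nonneg_right h4 hxθ0.le) (Real.rpow_nonneg hx0.le _)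
    have h3 : x ^ (1 / 4 : ℝ) + 1 ≤ 2 ^ k₀ * y / Lw := h2.trans h1
    have h4 : 2 ^ k₀ * y / Lw - 1 < (⌊2 ^ k₀ * y / Lw⌋₊ : ℝ) := Nat.sub_one_lt_floor _
    rw [← ha₀] at h4
    generalize x ^ (1 / 4 : ℝ) = q at h3 ⊢
    generalize 2 ^ k₀ * y / Lw = r at h3 h4 ⊢
    linarith only [h3, h4]
  have ha₀2 : 2 ≤ a₀ := by
    have h2 : ((2 : ℕ) : ℝ) ≤ (a₀ : ℝ) := by rw [Nat.cast_ofNat]; exact hx14.trans ha₀ge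
    exact Nat.cast_le.mp h2
  have hloga₀ : Real.log x / 4 ≤ Real.log a₀ := by
    have := Real.log_le_log (Real.rpow_pos_of_pos hx0 _) ha₀ge
    rwa [Real.log_rpow hx0, show (1 / 4 : ℝ) * Real.log x = Real.log x / 4 by ring] at this
  have ha₀le : ∀ ν : ℕ, 1 ≤ ν → (ν : ℝ) ≤ Lw → a₀ ≤ ⌊2 ^ k₀ * y / ν⌋₊ := by
    intro ν hν hνL
    rw [ha₀]
    refine Nat.floor_le_floor ?_
    exact div_le_div_of_nonneg_left hsy0 (by exact_mod_cast hν) hνL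
  -- the analytic sums
  have hBe : ∑ e ∈ (Icc 1 X).filter Squarefree, A.density e * (e.divisors.card : ℝ) * sigmaHalf e ≤
      E₂ * Real.log x ^ 2 :=
    (sum_squarefree_density_card_sigmaHalf_le hg hK h19 hX2).trans
      (mul_le_mul_of_nonneg_left (pow_le_pow_left₀ hlogX0 hlogX 2) (Real.exp_pos _).le)
  have hSgs : ∑ ν ∈ (Icc 1 X).filter Squarefree, A.density ν * sigmaHalf ν ≤ E₁ * Real.log x :=
    (sum_squarefree_density_sigmaHalf_le hg hK h19 hX2).trans
      (mul_le_mul_of_nonneg_left hlogX (Real.exp_pos _).le)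
  have hSgs0 : 0 ≤ ∑ ν ∈ (Icc 1 X).filter Squarefree, A.density ν * sigmaHalf ν :=
    Finset.sum_nonneg fun ν hν => mul_nonneg
      (ArithmeticFunction.IsMultiplicative.nonneg_of_squarefree hg hg0 (Finset.mem_filter.mp hν).2)
      (le_trans zero_le_one (one_le_sigmaHalf ν))
  -- (R′) at `x`, with a nonnegative constant
  set R := KR' * A.size x / Real.log x ^ 3 with hRdef
  have hl3 : 0 < Real.log x ^ 3 := pow_pos hlogx0 3
  have hl5 : 0 < Real.log x ^ 5 := pow_pos hlogx0 5
  have hR0 : 0 ≤ R := div_nonneg (mul_nonneg hKR'0 hA0) hl3.le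
  have hRx' : ∀ t : ℝ, t ≤ x →
      ∑ d ∈ (Icc 1 Dn).filter Squarefree, (divisorCountK 5 d : ℝ) * |A.remainder d t| ≤ R := by
    intro t ht
    refine (hRx t ht).trans ?_
    exact div_le_div_of_nonneg_right (mul_le_mul_of_nonneg_right (le_max_left _ _) hA0) hl3.le
  -- the reduced sieved bilinear bound on the dyadic pieces, for `u ∈ (Y/Lw, eY)` and `q < C₀`
  set KBx := KB' * A.size x / Real.log x ^ 5 with hKBx
  have hKBx0 : 0 ≤ KBx := div_nonneg (mul_nonneg hKB'0 hA0) hl5.le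
  have hB6' : ∀ u ∈ Set.Ioo (Y / Lw) (Real.exp 1 * Y), ∀ q ∈ Ico 1 C₀, ∀ i ∈ range k₀,
      ∑ m ∈ Icc 1 ⌊x⌋₊, (6 : ℝ) ^ m.primeFactors.card *
        |∑ n ∈ (Ioc ⌊2 ^ i * u⌋₊ ⌊2 * (2 ^ i * u)⌋₊).filter
            (fun n : ℕ => ((m * n : ℕ) : ℝ) ≤ x ∧ ∀ p ∈ n.primeFactors, P x ≤ (p : ℝ)),
          (SieveSequence.fiGamma (q : ℝ) n : ℝ) * (μ (m * n) : ℝ) * A.a (m * n)| ≤ KBx := by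
    intro u hu q hq i hi
    have hi' : i < k₀ := Finset.mem_range.mp hi
    have hu0 : 0 < u := lt_trans (div_pos hY0 hLw0) hu.1
    have hN1 : Real.sqrt (D x) / x ^ (2 * θ) < 2 ^ i * u := by
      have hle : Real.sqrt (D x) / x ^ (2 * θ) ≤ Y / Lw := by
        rw [hLw]
        show Real.sqrt (D x) / x ^ (2 * θ) ≤ Real.sqrt (D x) / x ^ (θ / 2) / x ^ (θ / 2)
        rw [div_div, ← Real.rpow_add hx0, add_halves]
        refine div_le_div_of_nonneg_left (Real.sqrt_nonneg _) (Real.rpow_pos_of_pos hx0 _) ?_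
        exact Real.rpow_le_rpow_of_exponent_le hx1 (by linarith only [hθ])
      calc Real.sqrt (D x) / x ^ (2 * θ) ≤ Y / Lw := hle
        _ < u := hu.1
        _ ≤ 2 ^ i * u := le_mul_of_one_le_left hu0.le (one_le_pow₀ one_le_two)
    have h2i : (2 : ℝ) ^ i ≤ 2 ^ k₀ / 2 := by
      rw [le_div_iff₀ two_pos, ← pow_succ]
      exact pow_le_pow_right₀ one_le_two (Nat.succ_le_of_lt hi')
    have he8 : Real.exp 1 / 8 < 1 :=
      (div_lt_one (by norm_num : (0 : ℝ) < 8)).mpr (Real.exp_one_lt_d9.trans (by norm_num))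
    have heY0 : 0 ≤ Real.exp 1 * Y := mul_nonneg (Real.exp_pos 1).le hY0.le
    have hq' : 0 < Real.sqrt x / δ := div_pos hsqrt0 hδ0
    have hN2 : 2 ^ i * u < Real.sqrt x / δ := by
      have hfe : fiSLow D α θ x * (Real.exp 1 * Y) = (Real.exp 1 / 8) * (Real.sqrt x / δ) := by
        calc fiSLow D α θ x * (Real.exp 1 * Y) = Real.exp 1 * (fiSLow D α θ x * Y) := by ring
          _ = Real.exp 1 * u₀ := by rw [hSY]
          _ = (Real.exp 1 / 8) * (Real.sqrt x / δ) := by rw [hu₀]; ring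
      calc 2 ^ i * u ≤ (2 ^ k₀ / 2) * (Real.exp 1 * Y) := mul_le_mul h2i hu.2.le hu0.le (div_nonneg hs0.le two_pos.le)
        _ ≤ fiSLow D α θ x * (Real.exp 1 * Y) :=
            mul_le_mul_of_nonneg_right (by linarith only [hsup]) heY0
        _ = (Real.exp 1 / 8) * (Real.sqrt x / δ) := hfe
        _ < 1 * (Real.sqrt x / δ) := mul_lt_mul_of_pos_right he8 hq'
        _ = Real.sqrt x / δ := one_mul _
    rw [hδ] at hN2
    have hq1 : (1 : ℝ) ≤ q := by exact_mod_cast (Finset.mem_Ico.mp hq).1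
    have hqC : (q : ℝ) ≤ x / D x := by
      have hqlt : q + 1 ≤ C₀ := (Finset.mem_Ico.mp hq).2
      have : (q : ℝ) + 1 ≤ C₀ := by exact_mod_cast hqlt
      linarith only [this, hC₀le]
    have h0 := hBx (2 ^ i * u) hN1 hN2 q hq1 hqC
    refine h0.trans ?_
    exact div_le_div_of_nonneg_right (mul_le_mul_of_nonneg_right (le_max_left _ _) hA0) hl5.le
  -- `W₁`: Rankin's saving under (10.2) and the sixth moment
  have hPx1 : 1 < P x := by linarith only [hparx.2.2.1]
  set E1 : ℝ := 2 * C6 * A.size x / Real.log x ^ 6 with hE1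
  have hE10 : 0 ≤ E1 := by positivity
  have hW1 : Real.log C₀ * ((Lw ^ (-(1 / Real.log (P x)))) *
      ∑ n ∈ Ioc 0 ⌊x⌋₊, A.a n * ((n.divisors.card : ℝ)) ^ 6) ≤ E1 := by
    have hx8 : (8 : ℝ) ≤ x := by linarith only [hx16]
    have hmom := hhyp.sum_a_mul_card_divisors_pow_six_le hx8 h16x
    have hrank : Lw ^ (-(1 / Real.log (P x))) ≤ Real.log x ^ (-(2 ^ 33 : ℝ)) := by
      rw [hLw]; exact rankin_rpow_le_log_rpow hx1' hll hθ hparx.2.2.1 hparx.2.2.2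
    have hrank0 : 0 ≤ Lw ^ (-(1 / Real.log (P x))) := Real.rpow_nonneg hLw0.le _
    have hmom0 : 0 ≤ ∑ n ∈ Ioc 0 ⌊x⌋₊, A.a n * ((n.divisors.card : ℝ)) ^ 6 :=
      Finset.sum_nonneg fun n _ => mul_nonneg (A.a_nonneg n) (by positivity)
    have hpow : Real.log x ^ (-(2 ^ 33 : ℝ)) * Real.log x ^ (2 ^ 26 : ℝ) ≤ (Real.log x ^ 7)⁻¹ := by
      have h7 : (Real.log x ^ 7)⁻¹ = Real.log x ^ (-(7 : ℝ)) := by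
        rw [Real.rpow_neg hlogx0.le, show (7 : ℝ) = ((7 : ℕ) : ℝ) by norm_num, Real.rpow_natCast]
      rw [h7, ← Real.rpow_add hlogx0]
      exact Real.rpow_le_rpow_of_exponent_le hlogx (by norm_num)
    calc Real.log C₀ * ((Lw ^ (-(1 / Real.log (P x)))) *
          ∑ n ∈ Ioc 0 ⌊x⌋₊, A.a n * ((n.divisors.card : ℝ)) ^ 6)
        ≤ (2 * Real.log x) * (Real.log x ^ (-(2 ^ 33 : ℝ)) * (C6 * A.size x * Real.log x ^ (2 ^ 26 : ℝ))) := by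
          refine mul_le_mul hlogC₀ (mul_le_mul hrank hmom hmom0 (Real.rpow_nonneg hlogx0.le _))
            (mul_nonneg hrank0 hmom0) (by positivity)
      _ = 2 * C6 * A.size x * Real.log x * (Real.log x ^ (-(2 ^ 33 : ℝ)) * Real.log x ^ (2 ^ 26 : ℝ)) := by ring
      _ ≤ 2 * C6 * A.size x * Real.log x * (Real.log x ^ 7)⁻¹ :=
          mul_le_mul_of_nonneg_left hpow (by positivity)
      _ = E1 := by rw [hE1]; field_simp
  -- the pointwise bound for `z ∈ (Y, eY]`
  set B₀ := Kstar * A.size x / Real.log x + 2 * R * Real.log x + E1 with hB₀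
  -- `W₀(z)`: the part of the `λ⁻`-sum with a small smooth variable, to be integrated over `z`
  set W0f : ℝ → ℝ := fun z => ∑ k ∈ Icc 1 ⌊x⌋₊, ((k.divisors.card : ℝ)) ^ 2 *
      ∑ n₁ ∈ (Icc 1 (⌊x⌋₊ / k)).filter (fun n : ℕ => Squarefree n ∧
          (∀ p ∈ n.primeFactors, (p : ℝ) < P x) ∧ (n : ℝ) ≤ Lw),
        (n₁.divisors.card : ℝ) * ∑ q ∈ Ico 1 C₀, Real.log (((q : ℝ) + 1) / q) *
          |∑ n₀ ∈ (Icc 1 (⌊x⌋₊ / (k * n₁))).filter (fun n : ℕ => ∀ p ∈ n.primeFactors, P x ≤ (p : ℝ)),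
            (if z / n₁ < (n₀ : ℝ) ∧ (n₀ : ℝ) ≤ 2 ^ k₀ * (z / n₁) then
              (SieveSequence.fiGamma (q : ℝ) n₀ : ℝ) * (μ n₀ : ℝ) * A.a (k * n₁ * n₀) else 0)| with hW0f
  have hW0f0 : ∀ z, 0 ≤ W0f z := fun z =>
    Finset.sum_nonneg fun k _ => mul_nonneg (by positivity) (Finset.sum_nonneg fun n₁ _ =>
      mul_nonneg (Nat.cast_nonneg _) (Finset.sum_nonneg fun q hq =>
        mul_nonneg (log_succ_div_nonneg (Finset.mem_Ico.mp hq).1) (abs_nonneg _)))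
  set Gf : ℝ → ℝ → ℝ := fun c z => ∑ d ∈ (Icc 1 Dn).filter Squarefree, ∑ k ∈ d.divisors,
      ((k.divisors.card : ℝ)) ^ 2 * |A.remainder d (min (c * ((k : ℝ) * z)) x)| with hGf
  have hGf0 : ∀ c z, 0 ≤ Gf c z := fun c z =>
    Finset.sum_nonneg fun d _ => Finset.sum_nonneg fun k _ => mul_nonneg (pow_nonneg (Nat.cast_nonneg _) 2) (abs_nonneg _)
  have hptw : ∀ z ∈ Set.Ioc Y (Real.exp 1 * Y),
      |A.fiS3 (lam x) (2 ^ k₀) x y z| ≤ B₀ + Real.log x * (Gf 1 z + Gf (2 ^ k₀) z) + W0f z := by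
    intro z hz
    have hz0 : 0 < z := hY0.trans hz.1
    have hz1 : 1 ≤ z := le_trans (le_trans (Real.one_le_rpow hx1 hθ₁.le) hYP) hz.1.le
    have hPz : Pw ≤ z := hYP.trans hz.1.le
    have h3 := A.abs_fiS3_le_three h116 hw hPz hz1 hx0.le hC1 (s := 2 ^ k₀) (y := y)
    -- `S*`
    have hstar := A.abs_S3star_le hsize hg0 h24' hw hC1 hx1 hz0 hsy0 ha₀2 ha₀le
    have hstar' : A.size x * ((∑ e ∈ (Icc 1 X).filter Squarefree,
        A.density e * (e.divisors.card : ℝ) * sigmaHalf e) *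
        (∑ ℓ ∈ (Icc 1 X).filter Squarefree, A.density ℓ * sigmaHalf ℓ) *
        (2 * |K₂₄| * Real.log x / Real.log a₀ ^ 6) *
        ∑ ν ∈ (Icc 1 X).filter Squarefree, A.density ν * sigmaHalf ν) ≤ Kstar * A.size x / Real.log x := by
      have hl4 : 0 < Real.log x / 4 := div_pos hlogx0 four_pos
      have hloga₀0 : 0 < Real.log a₀ := lt_of_lt_of_le hl4 hloga₀
      have h2K : 0 ≤ 2 * |K₂₄| * Real.log x := mul_nonneg (mul_nonneg two_pos.le (abs_nonneg _)) hlogx0.le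
      have hCst : 2 * |K₂₄| * Real.log x / Real.log a₀ ^ 6 ≤ 2 * |K₂₄| * Real.log x / (Real.log x / 4) ^ 6 :=
        div_le_div_of_nonneg_left h2K (pow_pos hl4 6) (pow_le_pow_left₀ hl4.le hloga₀ 6)
      have hCst0 : 0 ≤ 2 * |K₂₄| * Real.log x / Real.log a₀ ^ 6 := div_nonneg h2K (pow_pos hloga₀0 6).le
      calc A.size x * ((∑ e ∈ (Icc 1 X).filter Squarefree,
            A.density e * (e.divisors.card : ℝ) * sigmaHalf e) *
            (∑ ℓ ∈ (Icc 1 X).filter Squarefree, A.density ℓ * sigmaHalf ℓ) *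
            (2 * |K₂₄| * Real.log x / Real.log a₀ ^ 6) *
            ∑ ν ∈ (Icc 1 X).filter Squarefree, A.density ν * sigmaHalf ν)
          ≤ A.size x * ((E₂ * Real.log x ^ 2) * (E₁ * Real.log x) *
            (2 * |K₂₄| * Real.log x / (Real.log x / 4) ^ 6) * (E₁ * Real.log x)) := by
            refine mul_le_mul_of_nonneg_left ?_ hA0
            refine mul_le_mul (mul_le_mul (mul_le_mul hBe hSgs hSgs0 (by positivity)) hCst hCst0
              (by positivity)) hSgs hSgs0 (by positivity)
        _ = Kstar * A.size x / Real.log x := by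
            rw [hKstar]
            field_simp
    -- `S'`
    have hMf : ∀ k, |(truncGT (μ : ArithmeticFunction ℝ) (2 ^ k₀ * y) * ζ) k| ≤ (k.divisors.card : ℝ) :=
      fun k => abs_truncGT_moebius_mul_zeta_le _ k
    have hprime := A.abs_S3prime_le hsize hw hx1 (2 ^ k₀) hz0.le hC1 hDcond
      (fun k => (truncGT (μ : ArithmeticFunction ℝ) (2 ^ k₀ * y) * ζ) k) hMf
    have hP1 : ∑ d ∈ (Icc 1 Dn).filter Squarefree, (divisorCountK 5 d : ℝ) *
        ∑ n ∈ Icc 1 ⌊x⌋₊, |A.remainder d n| / n ≤ 2 * R * Real.log x := by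
      have hswap : ∑ d ∈ (Icc 1 Dn).filter Squarefree, (divisorCountK 5 d : ℝ) *
          ∑ n ∈ Icc 1 ⌊x⌋₊, |A.remainder d n| / n =
          ∑ n ∈ Icc 1 ⌊x⌋₊, (1 / (n : ℝ)) * ∑ d ∈ (Icc 1 Dn).filter Squarefree,
            (divisorCountK 5 d : ℝ) * |A.remainder d n| := by
        simp only [Finset.mul_sum]
        rw [Finset.sum_comm]
        refine Finset.sum_congr rfl fun n _ => Finset.sum_congr rfl fun d _ => ?_
        rw [div_eq_mul_one_div]; ring
      rw [hswap]
      calc ∑ n ∈ Icc 1 ⌊x⌋₊, (1 / (n : ℝ)) * ∑ d ∈ (Icc 1 Dn).filter Squarefree,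
            (divisorCountK 5 d : ℝ) * |A.remainder d n|
          ≤ ∑ n ∈ Icc 1 ⌊x⌋₊, (1 / (n : ℝ)) * R := by
            refine Finset.sum_le_sum fun n hn => mul_le_mul_of_nonneg_left (hRx' n ?_)
              (div_nonneg zero_le_one (Nat.cast_nonneg n))
            exact le_trans (by exact_mod_cast (Finset.mem_Icc.mp hn).2) (Nat.floor_le hx0.le)
        _ = (∑ n ∈ Icc 1 ⌊x⌋₊, (1 / (n : ℝ))) * R := by rw [Finset.sum_mul]
        _ ≤ (1 + Real.log X) * R := by
            refine mul_le_mul_of_nonneg_right ?_ hR0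
            have heq : ∑ n ∈ Icc 1 X, (1 : ℝ) / n = (harmonic X : ℝ) := by
              rw [harmonic_eq_sum_Icc]
              push_cast
              exact Finset.sum_congr rfl fun n _ => by rw [one_div]
            rw [heq]
            exact harmonic_le_one_add_log X
        _ ≤ 2 * R * Real.log x := by
            have h := mul_le_mul_of_nonneg_right
              (show 1 + Real.log X ≤ 2 * Real.log x by linarith only [hlogX, hlogx]) hR0
            linarith only [h]
    have hGeq : ∑ d ∈ (Icc 1 Dn).filter Squarefree, ∑ k ∈ d.divisors,
        ((k.divisors.card : ℝ)) ^ 2 *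
          (|A.remainder d (min ((k : ℝ) * z) x)| + |A.remainder d (min ((k : ℝ) * (2 ^ k₀ * z)) x)|) =
        Gf 1 z + Gf (2 ^ k₀) z := by
      rw [hGf]
      dsimp only
      rw [← Finset.sum_add_distrib]
      refine Finset.sum_congr rfl fun d _ => ?_
      rw [← Finset.sum_add_distrib]
      refine Finset.sum_congr rfl fun k _ => ?_
      rw [one_mul, show (k : ℝ) * (2 ^ k₀ * z) = 2 ^ k₀ * ((k : ℝ) * z) by ring]
      ring
    -- `S⁻`: the structural bound, then §10 (`W₀(z) + W₁`)
    have hminus := (abs_S3minus_le_weighted_sum (A := A) hw x y z (2 ^ k₀) C₀).trans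
      ((weighted_T_sum_le h116 hPx1 hLw0 ⌊x⌋₊ z (2 ^ k₀) hC1).trans (add_le_add le_rfl hW1))
    -- combine
    refine h3.trans ?_
    rw [hGeq] at hprime
    have hsum := add_le_add (add_le_add (hstar.trans hstar') (hprime.trans
      (add_le_add hP1 le_rfl))) hminus
    refine hsum.trans (le_of_eq ?_)
    rw [hB₀]; ring
  -- integrate over `z ∈ [Y, eY]`
  have hYe : Y ≤ Real.exp 1 * Y := le_mul_of_one_le_left hY0.le he1
  have hGint : ∀ c, IntervalIntegrable (fun z => Gf c z / z) volume Y (Real.exp 1 * Y) := fun c =>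
    A.intervalIntegrable_boundary_terms hsize x Dn hY0 hYe c
  have hGbound : ∀ c, ∫ z in Y..(Real.exp 1 * Y), Gf c z / z ≤ (1 + Real.log Dn) * R := fun c =>
    A.integral_boundary_terms_le hsize hDn1 hRx' hY0 c
  -- the integrated `W₀`
  obtain ⟨hW0int, hW0le⟩ := integral_W0_le h116 (P x) hx1 k₀ hY0 hLw1 hC1 hB6'
  set gfun : ℝ → ℝ := fun z => B₀ * z⁻¹ + Real.log x * (Gf 1 z / z) + Real.log x * (Gf (2 ^ k₀) z / z) +
    W0f z / z with hgfun
  have hinvint : IntervalIntegrable (fun z : ℝ => B₀ * z⁻¹) volume Y (Real.exp 1 * Y) := by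
    refine (intervalIntegral.intervalIntegrable_inv (fun u hu => ?_) continuousOn_id).const_mul _
    rw [Set.uIcc_of_le hYe] at hu
    exact (hY0.trans_le hu.1).ne'
  have hgint : IntervalIntegrable gfun volume Y (Real.exp 1 * Y) :=
    ((hinvint.add ((hGint 1).const_mul _)).add ((hGint (2 ^ k₀)).const_mul _)).add hW0int
  have hB₀0 : 0 ≤ B₀ :=
    add_nonneg (add_nonneg (div_nonneg (mul_nonneg hKstar0 hA0) hlogx0.le)
      (mul_nonneg (mul_nonneg two_pos.le hR0) hlogx0.le)) hE10
  -- `|∫ S₃ dz/z| ≤ ∫ gfun`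
  obtain ⟨Bd, hBd⟩ := A.exists_bound_fiS2_fiS3 (lam x) x
  have hfint : IntervalIntegrable (fun z => A.fiS3 (lam x) (2 ^ k₀) x y z / z) volume Y (Real.exp 1 * Y) := by
    refine intervalIntegrable_of_abs_le ((A.measurable_fiS3_right (lam x) (2 ^ k₀) x y).div measurable_id)
      (M := Bd / Y) fun z hz => ?_
    rw [Set.uIoc_of_le hYe] at hz
    have hz0 : 0 < z := hY0.trans hz.1
    show |A.fiS3 (lam x) (2 ^ k₀) x y z / z| ≤ Bd / Y
    rw [abs_div, abs_of_pos hz0]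
    calc |A.fiS3 (lam x) (2 ^ k₀) x y z| / z ≤ Bd / z :=
          div_le_div_of_nonneg_right (hBd (2 ^ k₀) y z).2 hz0.le
      _ ≤ Bd / Y := div_le_div_of_nonneg_left (le_trans (abs_nonneg _) (hBd (2 ^ k₀) y z).2) hY0 hz.1.le
  have hnorm : ∀ᵐ z : ℝ, z ∈ Set.Ioc Y (Real.exp 1 * Y) →
      ‖A.fiS3 (lam x) (2 ^ k₀) x y z / z‖ ≤ gfun z := by
    refine Filter.Eventually.of_forall fun z hz => ?_
    have hz0 : 0 < z := hY0.trans hz.1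
    rw [Real.norm_eq_abs, abs_div, abs_of_pos hz0, div_le_iff₀ hz0]
    refine (hptw z hz).trans (le_of_eq ?_)
    rw [hgfun]
    field_simp
    ring
  have hI : |A.fiS3Z (lam x) (2 ^ k₀) x y Y| ≤ ∫ z in Y..(Real.exp 1 * Y), gfun z := by
    have h := intervalIntegral.norm_integral_le_of_norm_le hYe hnorm hgint
    rw [Real.norm_eq_abs] at h
    simpa only [SieveSequence.fiS3Z, SieveSequence.logAvg] using h
  refine hI.trans ?_
  -- evaluate/bound `∫ gfun`
  have hgsplit : ∫ z in Y..(Real.exp 1 * Y), gfun z =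
      B₀ * (∫ z in Y..(Real.exp 1 * Y), z⁻¹) +
        Real.log x * (∫ z in Y..(Real.exp 1 * Y), Gf 1 z / z) +
        Real.log x * (∫ z in Y..(Real.exp 1 * Y), Gf (2 ^ k₀) z / z) +
        ∫ z in Y..(Real.exp 1 * Y), W0f z / z := by
    rw [hgfun, intervalIntegral.integral_add ((hinvint.add ((hGint 1).const_mul _)).add
        ((hGint (2 ^ k₀)).const_mul _)) hW0int,
      intervalIntegral.integral_add (hinvint.add ((hGint 1).const_mul _)) ((hGint (2 ^ k₀)).const_mul _),
      intervalIntegral.integral_add hinvint ((hGint 1).const_mul _),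
      intervalIntegral.integral_const_mul, intervalIntegral.integral_const_mul,
      intervalIntegral.integral_const_mul]
  rw [hgsplit, show (∫ z in Y..(Real.exp 1 * Y), z⁻¹) = 1 from integral_inv_Ioc_exp_mul hY0, mul_one]
  have hlogDn' : (1 + Real.log Dn) * R ≤ 2 * Real.log x * R :=
    mul_le_mul_of_nonneg_right (by linarith only [hlogDn, hlogx]) hR0
  have hG1 := (hGbound 1).trans hlogDn'
  have hG2 := (hGbound (2 ^ k₀)).trans hlogDn'
  -- numerics
  have hlogLw : 1 + Real.log Lw ≤ 2 * Real.log x := by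
    have hLwx : Lw ≤ x := by
      rw [hLw]
      calc x ^ (θ / 2) ≤ x ^ (1 : ℝ) := Real.rpow_le_rpow_of_exponent_le hx1 (by linarith only [hθ, hθ3])
        _ = x := Real.rpow_one x
    have : Real.log Lw ≤ Real.log x := Real.log_le_log hLw0 hLwx
    linarith only [this, hlogx]
  have hlogLw0 : 0 ≤ 1 + Real.log Lw := by
    have : 0 ≤ Real.log Lw := Real.log_nonneg hLw1
    linarith only [this]
  have hW0_le : Real.log C₀ * (k₀ * KBx) * (1 + Real.log Lw) ≤ 16 * KB' * A.size x / Real.log x := by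
    calc Real.log C₀ * (k₀ * KBx) * (1 + Real.log Lw)
        ≤ (2 * Real.log x) * ((4 * Real.log x) * KBx) * (2 * Real.log x) := by
          refine mul_le_mul (mul_le_mul hlogC₀ (mul_le_mul_of_nonneg_right hk₀ hKBx0)
            (mul_nonneg (Nat.cast_nonneg _) hKBx0) (mul_nonneg two_pos.le hlogx0.le)) hlogLw hlogLw0
            (mul_nonneg (mul_nonneg two_pos.le hlogx0.le) (mul_nonneg (by positivity) hKBx0))
      _ = 16 * KB' * A.size x / Real.log x ^ 2 := by rw [hKBx]; field_simp; ring
      _ ≤ 16 * KB' * A.size x / Real.log x := by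
          refine div_le_div_of_nonneg_left (mul_nonneg (mul_nonneg (by norm_num) hKB'0) hA0) hlogx0 ?_
          calc Real.log x = Real.log x ^ 1 := (pow_one _).symm
            _ ≤ Real.log x ^ 2 := pow_le_pow_right₀ hlogx (by norm_num)
  have hE1_le : E1 ≤ 2 * C6 * A.size x / Real.log x := by
    rw [hE1]
    refine div_le_div_of_nonneg_left (mul_nonneg (mul_nonneg two_pos.le hC60) hA0) hlogx0 ?_
    calc Real.log x = Real.log x ^ 1 := (pow_one _).symm
      _ ≤ Real.log x ^ 6 := pow_le_pow_right₀ hlogx (by norm_num)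
  have hRlog : 2 * R * Real.log x ≤ 2 * KR' * A.size x / Real.log x := by
    rw [hRdef]
    have : 2 * (KR' * A.size x / Real.log x ^ 3) * Real.log x = 2 * KR' * A.size x / Real.log x ^ 2 := by
      field_simp
    rw [this]
    refine div_le_div_of_nonneg_left (mul_nonneg (mul_nonneg two_pos.le hKR'0) hA0) hlogx0 ?_
    calc Real.log x = Real.log x ^ 1 := (pow_one _).symm
      _ ≤ Real.log x ^ 2 := pow_le_pow_right₀ hlogx (by norm_num)
  have hRlog2 : Real.log x * (2 * Real.log x * R) = 2 * KR' * A.size x / Real.log x := by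
    rw [hRdef]; field_simp
  calc B₀ + Real.log x * (∫ z in Y..(Real.exp 1 * Y), Gf 1 z / z) +
        Real.log x * (∫ z in Y..(Real.exp 1 * Y), Gf (2 ^ k₀) z / z) +
        ∫ z in Y..(Real.exp 1 * Y), W0f z / z
      ≤ B₀ + Real.log x * (2 * Real.log x * R) + Real.log x * (2 * Real.log x * R) +
          Real.log C₀ * (k₀ * KBx) * (1 + Real.log Lw) := by
        refine add_le_add (add_le_add (add_le_add le_rfl ?_) ?_) hW0le
        · exact mul_le_mul_of_nonneg_left hG1 hlogx0.le
        · exact mul_le_mul_of_nonneg_left hG2 hlogx0.le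
    _ ≤ Kstar * A.size x / Real.log x + 2 * KR' * A.size x / Real.log x +
          2 * C6 * A.size x / Real.log x + 2 * KR' * A.size x / Real.log x +
          2 * KR' * A.size x / Real.log x + 16 * KB' * A.size x / Real.log x := by
        rw [hRlog2, hB₀]
        linarith only [hW0_le, hRlog, hE1_le]
    _ = (Kstar + 16 * KB' + 6 * KR' + 2 * C6) * A.size x / Real.log x := by ring

/-- **FI (8.5) under (B*)**: `S₃(x; y, Z) ≪ A(x)(log x)⁻¹` over `FIRegimeRough` — discharge of the
named fact `fi_asp_S3_estimate_rough` (`…Rough`): the case `K_B* = 1` of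
`fi_asp_S3_estimate_roughK` (the bundled hypotheses `FIAsymptoticSieveHypothesesRough` demand (B*)
with the explicit constant `1`, `FIAsymptoticSieveHypothesesRough.bilinear_const`).
[cite: FriedlanderIwaniecASP1998, §8 (8.5) and §10 pp. 1063-1065] -/
theorem fi_asp_S3_estimate_rough_holds : fi_asp_S3_estimate_rough :=
  fun A D α θ θ₁ lam P hreg => fi_asp_S3_estimate_roughK A D α θ θ₁ lam P hreg.α_pos hreg.θ₁_pos
    hreg.θ₁_le hreg.θ_lt hreg.hyp.core hreg.hyp.params hreg.hyp.bilinear_const hreg.weights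

end Literature.NumberTheory.Sieve
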